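import Summits.AtomisticToContinuum.FouriersLaw.Theses.EmbeddedDrudeMourre
import Summits.AtomisticToContinuum.FouriersLaw.Theses.LatticeLandauDamping
import Summits.AtomisticToContinuum.FouriersLaw.Theorems.SuperadditiveResistance.Negative.KillCriteria
import Literature.Barriers.AtomisticToContinuum.FixedLengthNoConductivityControl
import Literature.Barriers.AtomisticToContinuum.HarmonicCrystalBallisticProofs

/-!
# Disproof of `AbelThermodynamicLimit` — standing adversary file

Crux `Summit.AtomisticToContinuum.FouriersLaw.Theses.EmbeddedDrudeMourre.AbelThermodynamicLimit`
(item `stmt-AtomisticToContinuum-12596`, route `EmbeddedDrudeMourre`, rank-4 crux), written by the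
crux disprover `refuter-cdisprove-stmt-AtomisticToContinuum-12596-0` (2026-08-15); §7 added by the seat of the
`rfl`-identical twin `LatticeLandauDamping.AbelThermodynamicLimit` (stmt-AtomisticToContinuum-14013),
`refuter-cdisprove-stmt-AtomisticToContinuum-14013-0` (2026-08-16) — SHARED file, each seat extends and never
rewrites the other's sections. The whole file is sorry-free and `lean check`ed (rc 0, axioms `propext`,
`Classical.choice`, `Quot.sound`).

Shape of the crux (`crux_iff`, by `Iff.rfl`):
`∀ ω₂ lam β γ > 0, Uniq → ∀ T > 0, (∃ μT D κ, Witness) → ∃ μT D κ, Witness ∧ TLconv T κ`, where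
`Witness` = DLR Gibbs state + measure-preserving infinite-volume dynamics + absolutely convergent
current correlations + `0 < κ` + Abel limit `T⁻² ∫₀^∞ e^{-νt} C_T(t) dt → κ` (`ν ↓ 0`), and
`TLconv T κ` = "every response sequence `Dn` of every steady family tends to `κ`".

## Findings (index)

* §1 STRUCTURE (positive, for provers). `response_unique`: under `Uniq` the response sequence is
  canonical; `crux_iff_pointwise`: the "∃ witness BEFORE ∀ family" order is immaterial — the crux is
  equivalent to its pointwise form; `crux_of_forall_witness`: the ∀-witness form implies it;
  `tlconv_kappa_unique`: the conclusion pins `κ = lim Dn` as soon as one response sequence exists;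
  `response_zero_one`: `Dn 0 = Dn 1 = 0` always.
* §2 LOAD-BEARING ANALYSIS. The bath coupling `γ` enters ONLY through `IsSteadyState`:
  `exists_witness_iff_gamma` (the witness hypothesis is literally `γ`-blind, by transport `rfl`),
  while at `γ = 0` the Dirac mass at the origin is a steady state of every finite chain at every
  pair of bath temperatures (`isSteadyState_dirac_origin`), its response vanishes, and hence
  `tlconv_gamma_zero_false : κ ≠ 0 → ¬ TLconv ω₂ lam β 0 T κ` and `conclusion_false_gamma_zero`.
  So ANY proof must use `0 < γ`, and can only do so through `Uniq` / the steadiness of the family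
  (`cruxShape_gamma_zero_iff`: extended to `γ = 0` the crux says "`Uniq` at `γ = 0` ⇒ no Abelian
  Green–Kubo witness exists at any `T`" — true only by failure of `Uniq` there, which §2a′ PROVES:
  `not_uniq_gamma_zero`, via a second weak steady state `Z⁻¹e^{-H}dqdp` of the isolated one-site
  chain, `OneSite.isSteadyState_μG`; so `cruxShape_gamma_zero` holds vacuously).
  `tlconv_false_of_nonpos`: the guard `0 < T` is necessary for the conclusion (for `T ≤ 0` the family
  is unconstrained at the temperatures `T ± δ/2`, which are never both positive) — and harmless:
  `not_isChainGibbsMeasure_of_nonpos` / `no_witness_of_nonpos` PROVE there is no DLR Gibbs state, hence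
  no witness, at `T ≤ 0` (finite-volume kernels are `Measure.tilted` of a non-normalisable density
  against an infinite a priori measure, i.e. `0`).
  Anharmonicity: `tlconv_harmonic_false` — at `lam = β = 0` the conclusion fails for EVERY `κ`
  (unconditional, from the PROVED Rieder–Lebowitz–Lieb fact `HarmonicChainBallisticFlux_holds`), so
  the `lam, β ≥ 0` extension of the crux is equivalent at the harmonic corner to the non-existence of
  a finite Abelian Green–Kubo limit for the ballistic chain (`cruxShape_harmonic_iff`).
  `Uniq` itself: not removable by any cheap model — at `γ > 0` no second weak steady state is known;
  where a second one is cheap (`γ = 0`) the conclusion is already dead.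
* §3 BARRIER REDUCTION. `hasBoundedResponse_of_crux`: the crux + `Uniq` + Abelian witnesses at all
  `T > 0` imply `Literature.Barriers.AtomisticToContinuum.HasBoundedResponse (pinnedChain …)`, the
  statement the catalogue entry `FixedLengthNoConductivityControl` records as never obtained for any
  deterministic anharmonic bulk (BLR 2000 §6.3: "Nothing is known about the dependence of `D` on
  `L`"). Any proof therefore contains an `N`-uniform bound on the finite-size conductivity.
* §4 WHY IT RESISTS DISPROOF (docstring of `resists`): a refutation needs, at one admissible
  parameter point, `Uniq` (item 0741, CEHR 2018 + Fokker–Planck identification, unformalised) AND a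
  steady family with response limits at all `N` (item 0717) AND either non-convergence of the
  canonical `Dn` or a mismatch with EVERY Abelian witness — i.e. a proof that Fourier's law fails or
  that `κ ≠ κ_GK^{Abel}` for the pinned quartic chain; no junk model reaches it because every junk
  `InfiniteChainDynamics`/measure pair violates DLR or measure preservation (carrier `∅` forces
  `μT = 0`; the constant flow forces `μT = δ_0`, not Gibbs), and every degenerate corner that kills
  the conclusion (γ = 0, lam = β = 0, T ≤ 0) also kills a hypothesis. Physically the matching
  `lim_N (N-1)J̃/δT = κ_GK` is PROVED for Hamiltonian chains with conservative bulk noise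
  (Bernardin–Olla 2005, JSP 121) and is the numerical consensus for φ⁴-type chains (Aoki–Kusnezov
  2000); it is open — not doubted — for deterministic bulks (BLR §7).
* §5 small print checked: `N = 0, 1` terms, filters (`𝓝[≠] 0`, `𝓝[>] 0`), Bochner/tsum junk only on
  the hypothesis side (`0 < κ` forces eventual integrability), `IsSteadyState` junk-free for smooth
  compactly supported test functions (generator image is continuous with compact support).
* §6 NEAR-MISSES: none sorried in this cycle; open ends are listed in the docstring of `resists`
  (no Abelian witness for the harmonic chain; `κ` shared by all witnesses).
* LANDING: refuters may land only `¬`-refutations (gate code `theorems.refuter`); the importable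
  subset of §2a/§2a′/§2b (γ-blindness, Dirac steady state, `not_nessUnique_gamma_zero`,
  `not_isChainGibbsMeasure_of_nonpos`) is packaged sorry-free for a PROVER to land as
  `Summits/AtomisticToContinuum/FouriersLaw/Theorems/AbelThermodynamicLimitNegative.lean`
  (attached to the item as evidence `AbelThermodynamicLimitNegative.lean`, `--supports stmt-12596`).
* §7 SEAT stmt-14013 (`LatticeLandauDamping.AbelThermodynamicLimit`, refuter-cdisprove-stmt-AtomisticToContinuum-14013-0,
  2026-08-16; the two cruxes are `rfl`-identical, `Seat14013.lattice_eq_sibling`, so §0–§6 hold verbatim for it and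
  §7 holds verbatim for stmt-12596).  NEW: (i) `NessUnique` is now PROVED in the tree ⇒ `Uniq` is DISCHARGED at every
  admissible point (`Seat14013.uniq_holds`), the crux is equivalent to its uniqueness-free form
  (`Seat14013.crux_iff_uniqFree`) and the refuter's exact target no longer contains a uniqueness proof
  (`Seat14013.not_crux_iff`: one admissible point, one `T > 0`, SOME witness, and for EVERY witness a steady family
  with a response sequence not tending to its `κ`); §4 (1) is thereby free, (2)–(3) remain.  (ii) LINE AUDIT of the
  lead's picked line `SketchIdeator2` (series-law-at-every-laplace-frequency; stubs QS, QSR, S3, SEAM, POS, S7): no stub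
  refuted; kernel-checked KILL CRITERIA for the stub SET (§7.2): QSR ⇒ its DC shadow = the conclusion of the live crux
  `SuperadditiveResistance` (stmt-11748), so that crux's landed rpow/log kills bite QSR verbatim
  (`Seat14013.not_qsrShape_of_rpow_correction`); QS ∧ QSR ∧ S3 ∧ POS force a TWO-SIDED `O(1)` envelope
  `N·Â(ν) − c ≤ F_N(ν) ≤ N·Â(ν) + C₁` on the whole window and hence the two-sided DC RATE `|(N−1)D_N − Nκ| = O(1)`
  (`Seat14013.twoSided_envelope`, `twoSided_dc_law`) — the plain line proves `D_N = κ + O(1/N)`, so ONE admissible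
  point with a slower finite-size law (from above OR below) kills the pair (`not_qsShape_of_excess_from_above` is the
  side the resistance crux cannot see); S3 pins `κ` across regular witnesses (`matching_pins_kappa`).  (iii) verdict
  and what would kill the line: docstring of `Seat14013.line_SketchIdeator2_verdict`.  LANDING (Negative lane, now open
  to refuters): `Theorems/AbelThermodynamicLimit/Negative/LoadBearing.lean` (p97988: §2a/§2b/§2c/§3 re-proved over
  landed lemmas for the Lattice decl, barrier reduction WITHOUT `hU`) and `…/Negative/SignLawsKillCriteria.lean` (§7.2).
-/

noncomputable section

open MeasureTheory Filter Set
open scoped Topology NNReal ContDiff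

namespace Summit.AtomisticToContinuum.FouriersLaw.Cruxes.AbelThermodynamicLimit.Disproof

open Literature.MathematicalPhysics.KineticTheory.HeatConduction
open Literature.Barriers.AtomisticToContinuum (HasBoundedResponse HarmonicChainBallisticFlux
  HarmonicChainBallisticFlux_holds)

/-! ## §0 Shorthand and the verbatim restatement -/

/-- Weak-NESS uniqueness for `pinnedChain ω₂ lam β γ` (the crux's hypothesis; verbatim the body of
`NessUnique` at the parameter point). -/
def Uniq (ω₂ lam β γ : ℝ) : Prop :=
  ∀ (N : ℕ) (T_L T_R : ℝ), 0 < T_L → 0 < T_R →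
    ∀ μ ν : Measure (PhaseSpace N),
      (pinnedChain ω₂ lam β γ).IsSteadyState N T_L T_R μ →
      (pinnedChain ω₂ lam β γ).IsSteadyState N T_L T_R ν → μ = ν

/-- The Abelian Green–Kubo witness predicate `W(μT, D, κ)` at temperature `T`. -/
def Witness (ω₂ lam β γ T : ℝ) (μT : Measure ChainConfig)
    (D : InfiniteChainDynamics (pinnedChain ω₂ lam β γ)) (κ : ℝ) : Prop :=
  (pinnedChain ω₂ lam β γ).IsChainGibbsMeasure T μT ∧ D.PreservesMeasure μT ∧
    (∀ t : ℝ, D.HasAbsConvergentCorrelation μT t) ∧ 0 < κ ∧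
    Tendsto (fun ν : ℝ => (T ^ 2)⁻¹ *
        ∫ t in Ioi (0 : ℝ), Real.exp (-(ν * t)) * D.currentCorrelation μT t)
      (𝓝[>] (0 : ℝ)) (𝓝 κ)

/-- A steady-state family of the finite chains (steady at all `N` and all positive bath
temperatures; unconstrained elsewhere). -/
def IsSteadyFamily (ω₂ lam β γ : ℝ) (μ : (N : ℕ) → ℝ → ℝ → Measure (PhaseSpace N)) : Prop :=
  ∀ (N : ℕ) (T_L T_R : ℝ), 0 < T_L → 0 < T_R →
    (pinnedChain ω₂ lam β γ).IsSteadyState N T_L T_R (μ N T_L T_R)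

/-- `Dn` is the sequence of finite-volume response coefficients of the family `μ` at `T`
(`Dn N = lim_{δ → 0, δ ≠ 0} totalCurrent(μ N (T+δ/2) (T-δ/2))/δ`). -/
def IsResponse (ω₂ lam β γ T : ℝ) (μ : (N : ℕ) → ℝ → ℝ → Measure (PhaseSpace N))
    (Dn : ℕ → ℝ) : Prop :=
  ∀ N : ℕ, Tendsto (fun δ : ℝ =>
      (pinnedChain ω₂ lam β γ).totalCurrent (μ N (T + δ / 2) (T - δ / 2)) / δ)
    (𝓝[≠] 0) (𝓝 (Dn N))

/-- The conclusion shape `TLconv(T, κ)`: every response sequence of every steady family tends to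
`κ`. -/
def TLconv (ω₂ lam β γ T κ : ℝ) : Prop :=
  ∀ μ : (N : ℕ) → ℝ → ℝ → Measure (PhaseSpace N), IsSteadyFamily ω₂ lam β γ μ →
    ∀ Dn : ℕ → ℝ, IsResponse ω₂ lam β γ T μ Dn → Tendsto Dn atTop (𝓝 κ)

/-- The crux at one parameter point, positivity guards stripped (so that degenerate corners can be
named): `Uniq → ∀ T > 0, (∃ W) → ∃ W ∧ TLconv`. -/
def CruxShape (ω₂ lam β γ : ℝ) : Prop :=
  Uniq ω₂ lam β γ → ∀ T : ℝ, 0 < T →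
    (∃ (μT : Measure ChainConfig) (D : InfiniteChainDynamics (pinnedChain ω₂ lam β γ)) (κ : ℝ),
        Witness ω₂ lam β γ T μT D κ) →
    ∃ (μT : Measure ChainConfig) (D : InfiniteChainDynamics (pinnedChain ω₂ lam β γ)) (κ : ℝ),
      Witness ω₂ lam β γ T μT D κ ∧ TLconv ω₂ lam β γ T κ

/-- The crux, restated through the shorthand — definitionally (`Iff.rfl`). -/
theorem crux_iff :
    Theses.EmbeddedDrudeMourre.AbelThermodynamicLimit ↔
      ∀ ω₂ lam β γ : ℝ, 0 < ω₂ → 0 < lam → 0 < β → 0 < γ → CruxShape ω₂ lam β γ :=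
  Iff.rfl

/-! ## §1 Structure: canonical response, immaterial witness order, `N = 0, 1` -/

instance : (𝓝[≠] (0 : ℝ)).NeBot := NormedField.nhdsNE_neBot 0

/-- Under `Uniq`, two steady families have the same difference quotients near `δ = 0`
(they agree at all positive temperatures, and `T ± δ/2 > 0` once `|δ| < 2T`). -/
theorem quotient_eventuallyEq {ω₂ lam β γ : ℝ} (hU : Uniq ω₂ lam β γ)
    {μ μ' : (N : ℕ) → ℝ → ℝ → Measure (PhaseSpace N)}
    (hμ : IsSteadyFamily ω₂ lam β γ μ) (hμ' : IsSteadyFamily ω₂ lam β γ μ') {T : ℝ} (hT : 0 < T)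
    (N : ℕ) :
    (fun δ : ℝ => (pinnedChain ω₂ lam β γ).totalCurrent (μ N (T + δ / 2) (T - δ / 2)) / δ)
      =ᶠ[𝓝[≠] 0]
    (fun δ : ℝ => (pinnedChain ω₂ lam β γ).totalCurrent (μ' N (T + δ / 2) (T - δ / 2)) / δ) := by
  have h2 : ∀ᶠ δ in 𝓝 (0 : ℝ), δ < 2 * T := eventually_lt_nhds (by linarith)
  have h2' : ∀ᶠ δ in 𝓝 (0 : ℝ), -(2 * T) < δ := eventually_gt_nhds (by linarith)
  filter_upwards [mem_nhdsWithin_of_mem_nhds h2, mem_nhdsWithin_of_mem_nhds h2'] with δ hlt hgt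
  have ha : 0 < T + δ / 2 := by linarith
  have hb : 0 < T - δ / 2 := by linarith
  rw [hU N _ _ ha hb _ _ (hμ N _ _ ha hb) (hμ' N _ _ ha hb)]

/-- CANONICAL RESPONSE: under `Uniq` the response sequence does not depend on the steady family
(limits along the proper filter `𝓝[≠] 0` are unique). -/
theorem response_unique {ω₂ lam β γ : ℝ} (hU : Uniq ω₂ lam β γ)
    {μ μ' : (N : ℕ) → ℝ → ℝ → Measure (PhaseSpace N)}
    (hμ : IsSteadyFamily ω₂ lam β γ μ) (hμ' : IsSteadyFamily ω₂ lam β γ μ') {T : ℝ} (hT : 0 < T)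
    {Dn Dn' : ℕ → ℝ} (hD : IsResponse ω₂ lam β γ T μ Dn) (hD' : IsResponse ω₂ lam β γ T μ' Dn') :
    Dn = Dn' :=
  funext fun N => tendsto_nhds_unique ((hD N).congr' (quotient_eventuallyEq hU hμ hμ' hT N)) (hD' N)

/-- Under `Uniq`, a response sequence of one steady family is a response sequence of every one. -/
theorem isResponse_transfer {ω₂ lam β γ : ℝ} (hU : Uniq ω₂ lam β γ)
    {μ μ' : (N : ℕ) → ℝ → ℝ → Measure (PhaseSpace N)}
    (hμ : IsSteadyFamily ω₂ lam β γ μ) (hμ' : IsSteadyFamily ω₂ lam β γ μ') {T : ℝ} (hT : 0 < T)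
    {Dn : ℕ → ℝ} (hD : IsResponse ω₂ lam β γ T μ Dn) : IsResponse ω₂ lam β γ T μ' Dn :=
  fun N => (hD N).congr' (quotient_eventuallyEq hU hμ hμ' hT N)

/-- The `κ` of the conclusion is PINNED by the finite chains as soon as one response sequence
exists: `TLconv T κ ∧ TLconv T κ' → κ = κ'`. So the crux asserts an IDENTITY
(`κ_Abel` of some witness `= lim_N D_N`), not merely convergence. -/
theorem tlconv_kappa_unique {ω₂ lam β γ T κ κ' : ℝ}
    (h : TLconv ω₂ lam β γ T κ) (h' : TLconv ω₂ lam β γ T κ')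
    {μ : (N : ℕ) → ℝ → ℝ → Measure (PhaseSpace N)} (hμ : IsSteadyFamily ω₂ lam β γ μ)
    {Dn : ℕ → ℝ} (hD : IsResponse ω₂ lam β γ T μ Dn) : κ = κ' :=
  tendsto_nhds_unique (h μ hμ Dn hD) (h' μ hμ Dn hD)

/-- VACUITY VALVE: if no steady family admits a response sequence at `T` (the situation unless item
`FiniteResponseOfUnique`, stmt-0717, holds), `TLconv T κ` is true for every `κ` and the crux is the
tautology `(∃ W) → (∃ W)`. -/
theorem tlconv_of_no_response {ω₂ lam β γ T : ℝ}
    (h : ∀ μ : (N : ℕ) → ℝ → ℝ → Measure (PhaseSpace N), IsSteadyFamily ω₂ lam β γ μ →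
      ∀ Dn : ℕ → ℝ, ¬ IsResponse ω₂ lam β γ T μ Dn) (κ : ℝ) : TLconv ω₂ lam β γ T κ :=
  fun μ hμ Dn hD => absurd hD (h μ hμ Dn)

/-- The ∀-witness form ("every Abelian witness has `Dn → κ`") implies the crux. (It is strictly
stronger only if two witnesses at one `T` can have different `κ` while a response sequence exists —
not excluded by the definitions, since `IsChainGibbsMeasure` admits non-translation-invariant DLR
states and `currentCorrelation` is anchored at bond `0`.) -/
theorem crux_of_forall_witness
    (h : ∀ ω₂ lam β γ : ℝ, 0 < ω₂ → 0 < lam → 0 < β → 0 < γ → Uniq ω₂ lam β γ →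
      ∀ T : ℝ, 0 < T → ∀ (μT : Measure ChainConfig)
        (D : InfiniteChainDynamics (pinnedChain ω₂ lam β γ)) (κ : ℝ),
        Witness ω₂ lam β γ T μT D κ → TLconv ω₂ lam β γ T κ) :
    Theses.EmbeddedDrudeMourre.AbelThermodynamicLimit := by
  rw [crux_iff]
  intro ω₂ lam β γ hω hl hβ hγ hU T hT ⟨μT, D, κ, hW⟩
  exact ⟨μT, D, κ, hW, h ω₂ lam β γ hω hl hβ hγ hU T hT μT D κ hW⟩

/-- POINTWISE FORM (route-review's informal remark, made a theorem): under `Uniq` the quantifier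
order "∃ witness, ∀ family" is immaterial — the crux is EQUIVALENT to: for every steady family and
every response sequence `Dn` there is an Abelian witness whose `κ` is `lim Dn`. (← uses
`response_unique`; if no response sequence exists the conclusion is vacuous, `tlconv_of_no_response`.) -/
theorem crux_iff_pointwise :
    Theses.EmbeddedDrudeMourre.AbelThermodynamicLimit ↔
      ∀ ω₂ lam β γ : ℝ, 0 < ω₂ → 0 < lam → 0 < β → 0 < γ → Uniq ω₂ lam β γ →
        ∀ T : ℝ, 0 < T →
          (∃ (μT : Measure ChainConfig) (D : InfiniteChainDynamics (pinnedChain ω₂ lam β γ)) (κ : ℝ),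
              Witness ω₂ lam β γ T μT D κ) →
          ∀ μ : (N : ℕ) → ℝ → ℝ → Measure (PhaseSpace N), IsSteadyFamily ω₂ lam β γ μ →
            ∀ Dn : ℕ → ℝ, IsResponse ω₂ lam β γ T μ Dn →
              ∃ (μT : Measure ChainConfig) (D : InfiniteChainDynamics (pinnedChain ω₂ lam β γ))
                (κ : ℝ), Witness ω₂ lam β γ T μT D κ ∧ Tendsto Dn atTop (𝓝 κ) := by
  rw [crux_iff]
  constructor
  · intro h ω₂ lam β γ hω hl hβ hγ hU T hT hex μ hμ Dn hD
    obtain ⟨μT, D, κ, hW, hTL⟩ := h ω₂ lam β γ hω hl hβ hγ hU T hT hex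
    exact ⟨μT, D, κ, hW, hTL μ hμ Dn hD⟩
  · intro h ω₂ lam β γ hω hl hβ hγ hU T hT hex
    by_cases hresp : ∃ μ : (N : ℕ) → ℝ → ℝ → Measure (PhaseSpace N), IsSteadyFamily ω₂ lam β γ μ ∧
        ∃ Dn : ℕ → ℝ, IsResponse ω₂ lam β γ T μ Dn
    · obtain ⟨μ₀, hμ₀, Dn₀, hD₀⟩ := hresp
      obtain ⟨μT, D, κ, hW, hlim⟩ := h ω₂ lam β γ hω hl hβ hγ hU T hT hex μ₀ hμ₀ Dn₀ hD₀
      refine ⟨μT, D, κ, hW, fun μ hμ Dn hD => ?_⟩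
      rwa [response_unique hU hμ hμ₀ hT hD hD₀]
    · obtain ⟨μT, D, κ, hW⟩ := hex
      refine ⟨μT, D, κ, hW, tlconv_of_no_response (fun μ hμ Dn hD => hresp ⟨μ, hμ, Dn, hD⟩) κ⟩

/-- The one-site chain carries no current (no bond). -/
theorem totalCurrent_one (P : OscillatorChain) (μ : Measure (PhaseSpace 1)) :
    P.totalCurrent μ = 0 := by
  simp [OscillatorChain.totalCurrent, OscillatorChain.bondCurrent]

/-- BOUNDARY TERMS: every response sequence has `Dn 0 = Dn 1 = 0` (`totalCurrent` vanishes for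
`N = 0, 1`), whatever the family — harmless for `atTop`, but it rules out conclusions of the form
"`Dn N = κ` for all `N`" or monotone approach from above. -/
theorem response_zero_one {ω₂ lam β γ T : ℝ} {μ : (N : ℕ) → ℝ → ℝ → Measure (PhaseSpace N)}
    {Dn : ℕ → ℝ} (hD : IsResponse ω₂ lam β γ T μ Dn) : Dn 0 = 0 ∧ Dn 1 = 0 := by
  constructor
  · have h : Tendsto (fun _ : ℝ => (0 : ℝ)) (𝓝[≠] (0 : ℝ)) (𝓝 (Dn 0)) := by
      simpa only [OscillatorChain.totalCurrent_zero, zero_div] using hD 0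
    exact tendsto_nhds_unique h tendsto_const_nhds
  · have h : Tendsto (fun _ : ℝ => (0 : ℝ)) (𝓝[≠] (0 : ℝ)) (𝓝 (Dn 1)) := by
      simpa only [totalCurrent_one, zero_div] using hD 1
    exact tendsto_nhds_unique h tendsto_const_nhds

/-! ## §2 Load-bearing analysis

### §2a The bath coupling `γ`: hypothesis `γ`-blind, conclusion dead at `γ = 0` -/

/-- Transport of an infinite-volume dynamics across the bath constant: `InfiniteChainDynamics`
only sees `U` and `V` (all proof fields are re-used verbatim — the types agree definitionally). -/
def transportD {ω₂ lam β γ : ℝ} (D : InfiniteChainDynamics (pinnedChain ω₂ lam β γ)) (γ' : ℝ) :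
    InfiniteChainDynamics (pinnedChain ω₂ lam β γ') :=
  ⟨D.carrier, D.flow, D.mapsTo, D.flow_zero, D.isSolution, D.unique⟩

/-- The witness predicate is literally independent of `γ` (`Iff.rfl` after transport): the Gibbs
specification, the dynamics, the bond currents and the Abel integral never mention the baths. -/
theorem witness_transport_iff {ω₂ lam β γ : ℝ} (γ' T : ℝ) (μT : Measure ChainConfig)
    (D : InfiniteChainDynamics (pinnedChain ω₂ lam β γ)) (κ : ℝ) :
    Witness ω₂ lam β γ T μT D κ ↔ Witness ω₂ lam β γ' T μT (transportD D γ') κ :=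
  Iff.rfl

/-- Hence the HYPOTHESIS of the crux at `(ω₂, lam, β, γ, T)` is equivalent to the same hypothesis at
any other bath constant `γ'` (in particular `γ' = 0`). -/
theorem exists_witness_iff_gamma (ω₂ lam β γ γ' T : ℝ) :
    (∃ (μT : Measure ChainConfig) (D : InfiniteChainDynamics (pinnedChain ω₂ lam β γ)) (κ : ℝ),
        Witness ω₂ lam β γ T μT D κ) ↔
      ∃ (μT : Measure ChainConfig) (D : InfiniteChainDynamics (pinnedChain ω₂ lam β γ')) (κ : ℝ),
        Witness ω₂ lam β γ' T μT D κ :=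
  ⟨fun ⟨μT, D, κ, h⟩ => ⟨μT, transportD D γ', κ, (witness_transport_iff γ' T μT D κ).1 h⟩,
    fun ⟨μT, D, κ, h⟩ => ⟨μT, transportD D γ, κ, (witness_transport_iff γ T μT D κ).1 h⟩⟩

/-- Bond currents vanish at the origin of phase space (`p = 0`). -/
theorem bondCurrent_origin (P : OscillatorChain) (N : ℕ) (i : Fin N) :
    P.bondCurrent N i (0 : PhaseSpace N) = 0 := by
  simp [OscillatorChain.bondCurrent]

/-- The Dirac mass at the origin carries no current. -/
theorem totalCurrent_dirac_origin (P : OscillatorChain) (N : ℕ) :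
    P.totalCurrent (Measure.dirac (0 : PhaseSpace N)) = 0 := by
  simp [OscillatorChain.totalCurrent, integral_dirac, bondCurrent_origin]

theorem update_zero_neg {N : ℕ} (i : Fin N) (t : ℝ) :
    Function.update (0 : Fin N → ℝ) i (-t) = -Function.update (0 : Fin N → ℝ) i t := by
  funext k
  by_cases hk : k = i
  · subst hk; simp
  · simp [Function.update_of_ne hk]

/-- The Hamiltonian of `pinnedChain` is even in the positions (`U`, `V` even). -/
theorem hamiltonian_neg_fst (ω₂ lam β γ : ℝ) (N : ℕ) (q p : Fin N → ℝ) :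
    (pinnedChain ω₂ lam β γ).hamiltonian N (-q, p) =
      (pinnedChain ω₂ lam β γ).hamiltonian N (q, p) := by
  simp only [OscillatorChain.hamiltonian, pinnedChain, Pi.neg_apply]
  congr 1
  · refine Finset.sum_congr rfl fun i _ => ?_
    ring
  · refine Finset.sum_congr rfl fun i _ => Finset.sum_congr rfl fun j _ => ?_
    split_ifs
    · ring
    · rfl

/-- `∂_{q_i} H` vanishes at the origin (the coordinate section `t ↦ H(0[i ↦ t], 0)` is even, and
`deriv` of an even function at `0` is `0` — no differentiability needed, `deriv_comp_neg`). -/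
theorem partialQ_hamiltonian_origin (ω₂ lam β γ : ℝ) (N : ℕ) (i : Fin N) :
    partialQ i ((pinnedChain ω₂ lam β γ).hamiltonian N) (0 : PhaseSpace N) = 0 := by
  unfold partialQ
  set g : ℝ → ℝ := fun t => (pinnedChain ω₂ lam β γ).hamiltonian N
    (Function.update (0 : Fin N → ℝ) i t, (0 : Fin N → ℝ)) with hg
  have heven : (fun t => g (-t)) = g := by
    funext t
    simp only [hg, update_zero_neg, hamiltonian_neg_fst]
  have h1 : deriv g 0 = -deriv g 0 := by
    conv_lhs => rw [← heven]
    rw [deriv_comp_neg]; simp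
  have h2 : deriv g 0 = 0 := by linarith
  simpa [hg] using h2

/-- At `γ = 0` the generator of every finite chain annihilates every observable at the origin
(momenta vanish, `∇_q H(0) = 0`, and the bath terms carry the factor `γ = 0`). -/
theorem generator_gamma_zero_origin (ω₂ lam β : ℝ) (N : ℕ) (T_L T_R : ℝ) (f : PhaseSpace N → ℝ) :
    (pinnedChain ω₂ lam β 0).generator N T_L T_R f 0 = 0 := by
  have hγ : (pinnedChain ω₂ lam β 0).γ = 0 := rfl
  rw [OscillatorChain.generator, hγ, zero_mul, add_zero]
  refine Finset.sum_eq_zero fun i _ => ?_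
  simp [partialQ_hamiltonian_origin]

theorem integral_generator_dirac_origin (ω₂ lam β : ℝ) (N : ℕ) (T_L T_R : ℝ)
    (f : PhaseSpace N → ℝ) :
    ∫ x, (pinnedChain ω₂ lam β 0).generator N T_L T_R f x ∂(Measure.dirac (0 : PhaseSpace N)) = 0 := by
  rw [integral_dirac]
  exact generator_gamma_zero_origin ω₂ lam β N T_L T_R f

theorem integrable_bondCurrent_dirac (P : OscillatorChain) (N : ℕ) (i : Fin N) (z : PhaseSpace N) :
    Integrable (P.bondCurrent N i) (Measure.dirac z) :=
  (integrable_const (P.bondCurrent N i z)).congr (ae_eq_dirac (P.bondCurrent N i)).symm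

/-- DEGENERATE STEADY STATE: at `γ = 0` the Dirac mass at the origin of phase space is a weak steady
state of the `N`-site chain for EVERY `N` and EVERY pair of bath temperatures (the temperatures have
dropped out of the generator). -/
theorem isSteadyState_dirac_origin (ω₂ lam β : ℝ) (N : ℕ) (T_L T_R : ℝ) :
    (pinnedChain ω₂ lam β 0).IsSteadyState N T_L T_R (Measure.dirac (0 : PhaseSpace N)) := by
  unfold OscillatorChain.IsSteadyState
  refine ⟨Measure.dirac.isProbabilityMeasure, fun f _ _ => ?_, fun i => ?_⟩
  · exact integral_generator_dirac_origin ω₂ lam β N T_L T_R f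
  · exact integrable_bondCurrent_dirac _ N i 0

/-- The constant Dirac family is a steady family at `γ = 0` … -/
theorem isSteadyFamily_dirac_gamma_zero (ω₂ lam β : ℝ) :
    IsSteadyFamily ω₂ lam β 0 (fun N _ _ => Measure.dirac (0 : PhaseSpace N)) :=
  fun N T_L T_R _ _ => isSteadyState_dirac_origin ω₂ lam β N T_L T_R

/-- … whose response sequence at every `T` is identically `0`, for any chain whose family is the
origin Dirac mass at the temperatures `T ± δ/2`, `δ ≠ 0`. -/
theorem isResponse_zero_of_dirac {ω₂ lam β γ T : ℝ} {μ : (N : ℕ) → ℝ → ℝ → Measure (PhaseSpace N)}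
    (h : ∀ N : ℕ, ∀ δ : ℝ, δ ≠ 0 → μ N (T + δ / 2) (T - δ / 2) = Measure.dirac 0) :
    IsResponse ω₂ lam β γ T μ (fun _ => 0) := by
  intro N
  refine (tendsto_const_nhds (x := (0 : ℝ))).congr' ?_
  filter_upwards [self_mem_nhdsWithin] with δ hδ
  rw [h N δ hδ, totalCurrent_dirac_origin, zero_div]

/-- `TLconv` evaluated on a zero response sequence forces `κ = 0`. -/
theorem kappa_eq_zero_of_tlconv {ω₂ lam β γ T κ : ℝ} (hTL : TLconv ω₂ lam β γ T κ)
    {μ : (N : ℕ) → ℝ → ℝ → Measure (PhaseSpace N)} (hμ : IsSteadyFamily ω₂ lam β γ μ)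
    (h0 : IsResponse ω₂ lam β γ T μ (fun _ => 0)) : κ = 0 :=
  (tendsto_nhds_unique tendsto_const_nhds (hTL μ hμ _ h0)).symm

/-- **`0 < γ` IS LOAD-BEARING (conclusion side).** At `γ = 0` the conclusion shape fails for every
`κ ≠ 0` and every `T`: the Dirac family is steady with zero response. -/
theorem tlconv_gamma_zero_false {ω₂ lam β T κ : ℝ} (hκ : κ ≠ 0) : ¬ TLconv ω₂ lam β 0 T κ :=
  fun hTL => hκ (kappa_eq_zero_of_tlconv hTL (isSteadyFamily_dirac_gamma_zero ω₂ lam β)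
    (isResponse_zero_of_dirac fun _ _ _ => rfl))

/-- Hence at `γ = 0` the full conclusion `∃ W ∧ TLconv` is FALSE outright (a witness has `0 < κ`),
for all `ω₂, lam, β, T` — while the hypothesis `∃ W` is the same as at any `γ > 0`
(`exists_witness_iff_gamma`). The bath coupling must therefore be USED by any proof, and it can only
enter through `Uniq` and the steadiness of the family (`IsSteadyState`), never through the
infinite-volume objects. -/
theorem conclusion_false_gamma_zero (ω₂ lam β T : ℝ) :
    ¬ ∃ (μT : Measure ChainConfig) (D : InfiniteChainDynamics (pinnedChain ω₂ lam β 0)) (κ : ℝ),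
        Witness ω₂ lam β 0 T μT D κ ∧ TLconv ω₂ lam β 0 T κ :=
  fun ⟨_, _, _, hW, hTL⟩ => tlconv_gamma_zero_false hW.2.2.2.1.ne' hTL

/-- THE `γ ≥ 0` EXTENSION, DECODED. At `γ = 0` the crux shape is equivalent to: "weak-NESS
uniqueness at `γ = 0` implies that NO Abelian Green–Kubo witness exists at any `T > 0`" — and by
`exists_witness_iff_gamma` the latter is the non-existence of a witness for the conjunct's own chain
at `γ > 0`, i.e. the failure of the whole route. The extension is nevertheless (expected to be) TRUE,
but only because `Uniq ω₂ lam β 0` fails (two invariant laws of the isolated chain; §2a′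
`not_uniq_gamma_zero`, PROVED). Moral for provers: `Uniq` is not a convenience normalising the
family quantifier — it is the only carrier of `γ`. -/
theorem cruxShape_gamma_zero_iff (ω₂ lam β : ℝ) :
    CruxShape ω₂ lam β 0 ↔
      (Uniq ω₂ lam β 0 → ∀ T : ℝ, 0 < T →
        ¬ ∃ (μT : Measure ChainConfig) (D : InfiniteChainDynamics (pinnedChain ω₂ lam β 0)) (κ : ℝ),
            Witness ω₂ lam β 0 T μT D κ) := by
  constructor
  · intro h hU T hT hex
    exact conclusion_false_gamma_zero ω₂ lam β T (h hU T hT hex)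
  · intro h hU T hT hex
    exact absurd hex (h hU T hT)

/-! ### §2a′ `Uniq` FAILS at `γ = 0`: a second weak steady state of the isolated one-site chain

The construction below (namespace `OneSite`) shows that for `ω₂ > 0`, `lam ≥ 0` the normalised
Gibbs-type law `Z⁻¹ e^{-(p²/2 + U(q))} dq dp` is a weak steady state of the ONE-site chain at
`γ = 0` (the generator is the Liouville operator `p∂_q - U'(q)∂_p`; `(Lf)·e^{-H}` is the divergence
`∂_q(p f e^{-H}) - ∂_p(U' f e^{-H})`, which integrates to zero by Fubini and `∫ h' = 0` for compactly
supported `C¹` sections). With `isSteadyState_dirac_origin` this gives two distinct steady states,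
hence `not_uniq_gamma_zero`, hence the crux shape holds at `γ = 0` VACUOUSLY
(`cruxShape_gamma_zero`). Technical content: transport `ℝ × ℝ ≃ᵐ PhaseSpace 1`
(`MeasurableEquiv.funUnique`), explicit `partialQ/partialP` in coordinates, product rule, Gaussian
domination for normalisability. -/

namespace OneSite

variable (ω₂ lam β : ℝ)

/-- shorthand: the isolated (`γ = 0`) pinned chain -/
abbrev P₀ (ω₂ lam β : ℝ) : OscillatorChain := pinnedChain ω₂ lam β 0

theorem hamiltonian_one (ω₂ lam β γ : ℝ) (x : PhaseSpace 1) :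
    (pinnedChain ω₂ lam β γ).hamiltonian 1 x =
      (x.2 0) ^ 2 / 2 + (ω₂ * (x.1 0) ^ 2 / 2 + lam * (x.1 0) ^ 4 / 4) := by
  simp [OscillatorChain.hamiltonian, pinnedChain]

theorem update_fin_one (v : Fin 1 → ℝ) (t : ℝ) : Function.update v 0 t = fun _ => t := by
  funext i
  rw [Subsingleton.elim i 0, Function.update_self]

theorem eq_const_fin_one (v : Fin 1 → ℝ) : v = fun _ => v 0 := by
  funext i; rw [Subsingleton.elim i 0]

theorem partialQ_hamiltonian_one (ω₂ lam β γ : ℝ) (x : PhaseSpace 1) :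
    partialQ 0 ((pinnedChain ω₂ lam β γ).hamiltonian 1) x = ω₂ * x.1 0 + lam * (x.1 0) ^ 3 := by
  unfold partialQ
  have h : (fun t => (pinnedChain ω₂ lam β γ).hamiltonian 1 (Function.update x.1 0 t, x.2)) =
      fun t => (x.2 0) ^ 2 / 2 + (ω₂ * t ^ 2 / 2 + lam * t ^ 4 / 4) := by
    funext t
    rw [hamiltonian_one]
    simp
  rw [h]
  have hd : HasDerivAt (fun t => (x.2 0) ^ 2 / 2 + (ω₂ * t ^ 2 / 2 + lam * t ^ 4 / 4))
      (ω₂ * x.1 0 + lam * (x.1 0) ^ 3) (x.1 0) := by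
    have hp2 : HasDerivAt (fun t : ℝ => t ^ 2) (2 * x.1 0) (x.1 0) := by
      simpa using hasDerivAt_pow 2 (x.1 0)
    have hp4 : HasDerivAt (fun t : ℝ => t ^ 4) (4 * (x.1 0) ^ 3) (x.1 0) := by
      simpa using hasDerivAt_pow 4 (x.1 0)
    have h3 := ((hp2.const_mul ω₂).div_const 2 |>.add ((hp4.const_mul lam).div_const 4)).const_add
      ((x.2 0) ^ 2 / 2)
    exact h3.congr_deriv (by ring)
  exact hd.deriv

theorem generator_one (T_L T_R : ℝ) (f : PhaseSpace 1 → ℝ) (x : PhaseSpace 1) :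
    (P₀ ω₂ lam β).generator 1 T_L T_R f x =
      x.2 0 * partialQ 0 f x - (ω₂ * x.1 0 + lam * (x.1 0) ^ 3) * partialP 0 f x := by
  have hγ : (P₀ ω₂ lam β).γ = 0 := rfl
  rw [OscillatorChain.generator, hγ, zero_mul, add_zero, Fin.sum_univ_one, partialQ_hamiltonian_one]

/-- the coordinate map `ℝ × ℝ → PhaseSpace 1` -/
def Φ (z : ℝ × ℝ) : PhaseSpace 1 := (fun _ => z.1, fun _ => z.2)

theorem Φ_surj (x : PhaseSpace 1) : Φ (x.1 0, x.2 0) = x := by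
  unfold Φ
  ext i <;> simp [Subsingleton.elim i 0]

theorem partialQ_Φ (f : PhaseSpace 1 → ℝ) (z : ℝ × ℝ) :
    partialQ 0 f (Φ z) = deriv (fun s => f (Φ (s, z.2))) z.1 := by
  unfold partialQ Φ
  simp only
  congr 1
  funext t
  rw [update_fin_one]

theorem partialP_Φ (f : PhaseSpace 1 → ℝ) (z : ℝ × ℝ) :
    partialP 0 f (Φ z) = deriv (fun s => f (Φ (z.1, s))) z.2 := by
  unfold partialP Φ
  simp only
  congr 1
  funext t
  rw [update_fin_one]

/-- the measurable equivalence realising `Φ` -/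
def E : ℝ × ℝ ≃ᵐ PhaseSpace 1 :=
  MeasurableEquiv.prodCongr (MeasurableEquiv.funUnique (Fin 1) ℝ).symm
    (MeasurableEquiv.funUnique (Fin 1) ℝ).symm

theorem E_apply (z : ℝ × ℝ) : E z = Φ z := by
  unfold E Φ
  ext i
  · simp [MeasurableEquiv.prodCongr, MeasurableEquiv.funUnique]
  · simp [MeasurableEquiv.prodCongr, MeasurableEquiv.funUnique]

theorem measurePreserving_E : MeasurePreserving E (volume : Measure (ℝ × ℝ)) (volume : Measure (PhaseSpace 1)) := by
  have h := (volume_preserving_funUnique (Fin 1) ℝ).symm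
  exact h.prod h

theorem integral_comp_Φ (g : PhaseSpace 1 → ℝ) :
    ∫ x, g x ∂(volume : Measure (PhaseSpace 1)) = ∫ z, g (Φ z) ∂(volume : Measure (ℝ × ℝ)) := by
  rw [← measurePreserving_E.integral_comp']
  simp_rw [E_apply]


/-! ### Step E: two-dimensional analysis -/

/-- the unnormalised Gibbs density of the one-site chain, on `ℝ × ℝ` (position, momentum) -/
def r (ω₂ lam : ℝ) (z : ℝ × ℝ) : ℝ :=
  Real.exp (-(z.2 ^ 2 / 2 + (ω₂ * z.1 ^ 2 / 2 + lam * z.1 ^ 4 / 4)))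

/-- `U'` -/
def Up (ω₂ lam : ℝ) (a : ℝ) : ℝ := ω₂ * a + lam * a ^ 3

theorem r_pos (ω₂ lam : ℝ) (z : ℝ × ℝ) : 0 < r ω₂ lam z := Real.exp_pos _

theorem contDiff_r (ω₂ lam : ℝ) : ContDiff ℝ ∞ (r ω₂ lam) := by
  unfold r
  fun_prop

theorem continuous_r (ω₂ lam : ℝ) : Continuous (r ω₂ lam) := (contDiff_r ω₂ lam).continuous

theorem continuous_Up (ω₂ lam : ℝ) : Continuous (Up ω₂ lam) := by
  unfold Up; fun_prop

theorem hasDerivAt_r_fst (ω₂ lam a b : ℝ) :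
    HasDerivAt (fun s => r ω₂ lam (s, b)) (-(Up ω₂ lam a) * r ω₂ lam (a, b)) a := by
  have hp2 : HasDerivAt (fun t : ℝ => t ^ 2) (2 * a) a := by simpa using hasDerivAt_pow 2 a
  have hp4 : HasDerivAt (fun t : ℝ => t ^ 4) (4 * a ^ 3) a := by simpa using hasDerivAt_pow 4 a
  have hg : HasDerivAt (fun s : ℝ => -(b ^ 2 / 2 + (ω₂ * s ^ 2 / 2 + lam * s ^ 4 / 4)))
      (-(Up ω₂ lam a)) a := by
    have := (((hp2.const_mul ω₂).div_const 2).add ((hp4.const_mul lam).div_const 4)).const_add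
      (b ^ 2 / 2)
    exact this.neg.congr_deriv (by unfold Up; ring)
  have := hg.exp
  unfold r
  exact this.congr_deriv (by ring)

theorem hasDerivAt_r_snd (ω₂ lam a b : ℝ) :
    HasDerivAt (fun s => r ω₂ lam (a, s)) (-b * r ω₂ lam (a, b)) b := by
  have hp2 : HasDerivAt (fun t : ℝ => t ^ 2) (2 * b) b := by simpa using hasDerivAt_pow 2 b
  have hg : HasDerivAt (fun s : ℝ => -(s ^ 2 / 2 + (ω₂ * a ^ 2 / 2 + lam * a ^ 4 / 4))) (-b) b := by
    have := (hp2.div_const 2).add_const (ω₂ * a ^ 2 / 2 + lam * a ^ 4 / 4)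
    exact this.neg.congr_deriv (by ring)
  have := hg.exp
  unfold r
  exact this.congr_deriv (by ring)

/-- `∫_ℝ h' = 0` for `h ∈ C¹` with compact support. -/
theorem integral_deriv_eq_zero {h : ℝ → ℝ} (hh : ContDiff ℝ 1 h) (hs : HasCompactSupport h) :
    ∫ x, deriv h x = 0 := by
  have hd : ∀ x, HasDerivAt h (deriv h x) x := fun x => ((hh.differentiable (by simp)) x).hasDerivAt
  have hc : Continuous (deriv h) := hh.continuous_deriv le_rfl
  have hi : Integrable (deriv h) := hc.integrable_of_hasCompactSupport hs.deriv
  have h0 : Tendsto h (cocompact ℝ) (𝓝 0) := hs.is_zero_at_infty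
  have key := integral_of_hasDerivAt_of_tendsto hd hi (h0.mono_left atBot_le_cocompact)
    (h0.mono_left atTop_le_cocompact)
  simpa using key

section TwoD

variable {F : ℝ × ℝ → ℝ} (hF : ContDiff ℝ ∞ F) (hFs : HasCompactSupport F)

/-- first partial derivative -/
def D1 (F : ℝ × ℝ → ℝ) (z : ℝ × ℝ) : ℝ := fderiv ℝ F z (1, 0)
/-- second partial derivative -/
def D2 (F : ℝ × ℝ → ℝ) (z : ℝ × ℝ) : ℝ := fderiv ℝ F z (0, 1)

include hF in
theorem hasDerivAt_sec1 (a b : ℝ) : HasDerivAt (fun s => F (s, b)) (D1 F (a, b)) a := by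
  have h1 : HasDerivAt (fun s : ℝ => (s, b)) ((1 : ℝ), (0 : ℝ)) a :=
    (hasDerivAt_id a).prodMk (hasDerivAt_const a b)
  have h2 := (hF.differentiable (by simp) (a, b)).hasFDerivAt
  exact h2.comp_hasDerivAt a h1

include hF in
theorem hasDerivAt_sec2 (a b : ℝ) : HasDerivAt (fun s => F (a, s)) (D2 F (a, b)) b := by
  have h1 : HasDerivAt (fun s : ℝ => (a, s)) ((0 : ℝ), (1 : ℝ)) b :=
    (hasDerivAt_const b a).prodMk (hasDerivAt_id b)
  have h2 := (hF.differentiable (by simp) (a, b)).hasFDerivAt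
  exact h2.comp_hasDerivAt b h1

include hF in
theorem continuous_D1 : Continuous (D1 F) :=
  (hF.continuous_fderiv (by simp)).clm_apply continuous_const

include hF in
theorem continuous_D2 : Continuous (D2 F) :=
  (hF.continuous_fderiv (by simp)).clm_apply continuous_const

theorem D1_eq_zero {z : ℝ × ℝ} (hz : z ∉ tsupport F) : D1 F z = 0 := by
  simp [D1, fderiv_of_notMem_tsupport ℝ hz]

theorem D2_eq_zero {z : ℝ × ℝ} (hz : z ∉ tsupport F) : D2 F z = 0 := by
  simp [D2, fderiv_of_notMem_tsupport ℝ hz]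

/-- the integrand `(L f) ρ` in coordinates -/
def G (ω₂ lam : ℝ) (F : ℝ × ℝ → ℝ) (z : ℝ × ℝ) : ℝ :=
  (z.2 * D1 F z - Up ω₂ lam z.1 * D2 F z) * r ω₂ lam z

/-- `∂_a (b F r)` -/
def G1 (ω₂ lam : ℝ) (F : ℝ × ℝ → ℝ) (z : ℝ × ℝ) : ℝ :=
  z.2 * (D1 F z * r ω₂ lam z + F z * (-(Up ω₂ lam z.1) * r ω₂ lam z))

/-- `∂_b (U'(a) F r)` -/
def G2 (ω₂ lam : ℝ) (F : ℝ × ℝ → ℝ) (z : ℝ × ℝ) : ℝ :=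
  Up ω₂ lam z.1 * (D2 F z * r ω₂ lam z + F z * (-z.2 * r ω₂ lam z))

theorem G_eq (z : ℝ × ℝ) : G ω₂ lam F z = G1 ω₂ lam F z - G2 ω₂ lam F z := by
  unfold G G1 G2; ring

include hF in
theorem hasDerivAt_G1 (a b : ℝ) :
    HasDerivAt (fun s => b * (F (s, b) * r ω₂ lam (s, b))) (G1 ω₂ lam F (a, b)) a := by
  have := ((hasDerivAt_sec1 hF a b).mul (hasDerivAt_r_fst ω₂ lam a b)).const_mul b
  exact this.congr_deriv (by unfold G1; ring)

include hF in
theorem hasDerivAt_G2 (a b : ℝ) :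
    HasDerivAt (fun s => Up ω₂ lam a * (F (a, s) * r ω₂ lam (a, s))) (G2 ω₂ lam F (a, b)) b := by
  have := ((hasDerivAt_sec2 hF a b).mul (hasDerivAt_r_snd ω₂ lam a b)).const_mul (Up ω₂ lam a)
  exact this.congr_deriv (by unfold G2; ring)

include hF hFs in
/-- the `a`-sections `s ↦ b F(s,b) r(s,b)` are `C¹` with compact support, so their derivative
integrates to zero -/
theorem integral_G1_section (b : ℝ) : ∫ a, G1 ω₂ lam F (a, b) = 0 := by
  set h : ℝ → ℝ := fun s => b * (F (s, b) * r ω₂ lam (s, b)) with hh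
  have hderiv : ∀ a, deriv h a = G1 ω₂ lam F (a, b) := fun a => (hasDerivAt_G1 ω₂ lam hF a b).deriv
  have hC : ContDiff ℝ 1 h := by
    have h1 : ContDiff ℝ 1 (fun s : ℝ => F (s, b)) :=
      (hF.of_le (by simp)).comp (contDiff_id.prodMk contDiff_const)
    have h2 : ContDiff ℝ 1 (fun s : ℝ => r ω₂ lam (s, b)) :=
      ((contDiff_r ω₂ lam).of_le (by simp)).comp (contDiff_id.prodMk contDiff_const)
    exact contDiff_const.mul (h1.mul h2)
  have hS : HasCompactSupport h := by
    refine HasCompactSupport.intro (hFs.image continuous_fst) fun s hs => ?_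
    have hF0 : F (s, b) = 0 := by
      by_contra hne
      exact hs ⟨(s, b), subset_tsupport _ hne, rfl⟩
    simp [hh, hF0]
  calc ∫ a, G1 ω₂ lam F (a, b) = ∫ a, deriv h a := by simp_rw [hderiv]
    _ = 0 := integral_deriv_eq_zero hC hS

include hF hFs in
theorem integral_G2_section (a : ℝ) : ∫ b, G2 ω₂ lam F (a, b) = 0 := by
  set h : ℝ → ℝ := fun s => Up ω₂ lam a * (F (a, s) * r ω₂ lam (a, s)) with hh
  have hderiv : ∀ b, deriv h b = G2 ω₂ lam F (a, b) := fun b => (hasDerivAt_G2 ω₂ lam hF a b).deriv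
  have hC : ContDiff ℝ 1 h := by
    have h1 : ContDiff ℝ 1 (fun s : ℝ => F (a, s)) :=
      (hF.of_le (by simp)).comp (contDiff_const.prodMk contDiff_id)
    have h2 : ContDiff ℝ 1 (fun s : ℝ => r ω₂ lam (a, s)) :=
      ((contDiff_r ω₂ lam).of_le (by simp)).comp (contDiff_const.prodMk contDiff_id)
    exact contDiff_const.mul (h1.mul h2)
  have hS : HasCompactSupport h := by
    refine HasCompactSupport.intro (hFs.image continuous_snd) fun s hs => ?_
    have hF0 : F (a, s) = 0 := by
      by_contra hne
      exact hs ⟨(a, s), subset_tsupport _ hne, rfl⟩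
    simp [hh, hF0]
  calc ∫ b, G2 ω₂ lam F (a, b) = ∫ b, deriv h b := by simp_rw [hderiv]
    _ = 0 := integral_deriv_eq_zero hC hS

include hF hFs in
theorem integrable_G1 : Integrable (G1 ω₂ lam F) (volume : Measure (ℝ × ℝ)) := by
  have hc : Continuous (G1 ω₂ lam F) := by
    unfold G1
    have := continuous_D1 hF; have := continuous_r ω₂ lam; have := continuous_Up ω₂ lam
    have := hF.continuous
    fun_prop
  refine hc.integrable_of_hasCompactSupport ?_
  refine HasCompactSupport.intro hFs fun z hz => ?_
  simp [G1, D1_eq_zero hz, image_eq_zero_of_notMem_tsupport hz]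

include hF hFs in
theorem integrable_G2 : Integrable (G2 ω₂ lam F) (volume : Measure (ℝ × ℝ)) := by
  have hc : Continuous (G2 ω₂ lam F) := by
    unfold G2
    have := continuous_D2 hF; have := continuous_r ω₂ lam; have := continuous_Up ω₂ lam
    have := hF.continuous
    fun_prop
  refine hc.integrable_of_hasCompactSupport ?_
  refine HasCompactSupport.intro hFs fun z hz => ?_
  simp [G2, D2_eq_zero hz, image_eq_zero_of_notMem_tsupport hz]

include hF hFs in
/-- **The divergence integrates to zero**: `∫∫ (b ∂_a F - U'(a) ∂_b F) e^{-H} da db = 0`. -/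
theorem integral_G_eq_zero : ∫ z, G ω₂ lam F z = 0 := by
  have h1 : ∫ z, G1 ω₂ lam F z = 0 := by
    rw [Measure.volume_eq_prod, integral_prod_symm _ (integrable_G1 ω₂ lam hF hFs)]
    simp [integral_G1_section ω₂ lam hF hFs]
  have h2 : ∫ z, G2 ω₂ lam F z = 0 := by
    rw [Measure.volume_eq_prod, integral_prod _ (integrable_G2 ω₂ lam hF hFs)]
    simp [integral_G2_section ω₂ lam hF hFs]
  calc ∫ z, G ω₂ lam F z = ∫ z, (G1 ω₂ lam F z - G2 ω₂ lam F z) := by simp_rw [G_eq]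
    _ = (∫ z, G1 ω₂ lam F z) - ∫ z, G2 ω₂ lam F z :=
        integral_sub (integrable_G1 ω₂ lam hF hFs) (integrable_G2 ω₂ lam hF hFs)
    _ = 0 := by rw [h1, h2, sub_zero]

end TwoD

/-! ### Step F: the Gibbs-type steady state of the isolated one-site chain -/

/-- `Φ` as a homeomorphism -/
def ΦH : ℝ × ℝ ≃ₜ PhaseSpace 1 :=
  Homeomorph.prodCongr (Homeomorph.funUnique (Fin 1) ℝ).symm (Homeomorph.funUnique (Fin 1) ℝ).symm

theorem ΦH_apply (z : ℝ × ℝ) : ΦH z = Φ z := by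
  unfold ΦH Φ
  ext i
  · simp [Homeomorph.prodCongr, Homeomorph.funUnique]
  · simp [Homeomorph.prodCongr, Homeomorph.funUnique]

theorem contDiff_Φ : ContDiff ℝ ∞ Φ := by
  unfold Φ
  exact (contDiff_pi.2 fun _ => contDiff_fst).prodMk (contDiff_pi.2 fun _ => contDiff_snd)

/-- the density on phase space -/
def ρ (ω₂ lam : ℝ) (x : PhaseSpace 1) : ℝ := r ω₂ lam (x.1 0, x.2 0)

theorem ρ_Φ (z : ℝ × ℝ) : ρ ω₂ lam (Φ z) = r ω₂ lam z := rfl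

theorem ρ_pos (x : PhaseSpace 1) : 0 < ρ ω₂ lam x := r_pos _ _ _

theorem continuous_ρ : Continuous (ρ ω₂ lam) := by
  unfold ρ
  exact (continuous_r ω₂ lam).comp (by fun_prop)

/-- **Main identity**: `∫ (L f) ρ d vol = 0` on `PhaseSpace 1` for the isolated one-site chain. -/
theorem integral_generator_mul_ρ (T_L T_R : ℝ) (f : PhaseSpace 1 → ℝ) (hf : ContDiff ℝ ∞ f)
    (hfs : HasCompactSupport f) :
    ∫ x, (P₀ ω₂ lam β).generator 1 T_L T_R f x * ρ ω₂ lam x = 0 := by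
  set F : ℝ × ℝ → ℝ := f ∘ Φ with hFdef
  have hF : ContDiff ℝ ∞ F := hf.comp contDiff_Φ
  have hFs : HasCompactSupport F := by
    have h := hfs.comp_homeomorph ΦH
    have : f ∘ ΦH = F := by funext z; simp [hFdef, ΦH_apply]
    rwa [this] at h
  rw [integral_comp_Φ]
  have hpt : ∀ z : ℝ × ℝ,
      (P₀ ω₂ lam β).generator 1 T_L T_R f (Φ z) * ρ ω₂ lam (Φ z) = G ω₂ lam F z := by
    intro z
    rw [generator_one, partialQ_Φ, partialP_Φ]
    have e1 : deriv (fun s => f (Φ (s, z.2))) z.1 = D1 F (z.1, z.2) :=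
      (hasDerivAt_sec1 hF z.1 z.2).deriv
    have e2 : deriv (fun s => f (Φ (z.1, s))) z.2 = D2 F (z.1, z.2) :=
      (hasDerivAt_sec2 hF z.1 z.2).deriv
    have h1 : (Φ z).1 0 = z.1 := rfl
    have h2 : (Φ z).2 0 = z.2 := rfl
    simp only [h1, h2, Prod.mk.eta] at e1 e2 ⊢
    rw [e1, e2, ρ_Φ]
    rfl
  simp_rw [hpt]
  exact integral_G_eq_zero ω₂ lam hF hFs

/-- integrability of the density (Gaussian domination; needs `ω₂ > 0`, `lam ≥ 0`) -/
theorem integrable_r (hω : 0 < ω₂) (hl : 0 ≤ lam) : Integrable (r ω₂ lam) (volume : Measure (ℝ × ℝ)) := by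
  have hB : Integrable (fun z : ℝ × ℝ => Real.exp (-(ω₂ / 2) * z.1 ^ 2) * Real.exp (-(1 / 2) * z.2 ^ 2))
      (volume : Measure (ℝ × ℝ)) := by
    rw [Measure.volume_eq_prod]
    exact (integrable_exp_neg_mul_sq (by linarith)).mul_prod (integrable_exp_neg_mul_sq (by norm_num))
  refine hB.mono' (continuous_r ω₂ lam).aestronglyMeasurable (Eventually.of_forall fun z => ?_)
  rw [Real.norm_eq_abs, abs_of_pos (r_pos _ _ _), r, ← Real.exp_add]
  apply Real.exp_le_exp.2
  have : 0 ≤ lam * z.1 ^ 4 / 4 := by positivity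
  nlinarith

theorem integrable_ρ (hω : 0 < ω₂) (hl : 0 ≤ lam) : Integrable (ρ ω₂ lam) (volume : Measure (PhaseSpace 1)) := by
  rw [← measurePreserving_E.integrable_comp_emb E.measurableEmbedding]
  have : ρ ω₂ lam ∘ E = r ω₂ lam := by funext z; simp [Function.comp, E_apply, ρ_Φ]
  rw [this]
  exact integrable_r ω₂ lam hω hl

/-- the density as an `ℝ≥0`-valued function -/
def ρ' (ω₂ lam : ℝ) (x : PhaseSpace 1) : ℝ≥0 := (ρ ω₂ lam x).toNNReal

theorem coe_ρ' (x : PhaseSpace 1) : (ρ' ω₂ lam x : ℝ) = ρ ω₂ lam x :=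
  Real.coe_toNNReal _ (ρ_pos ω₂ lam x).le

theorem measurable_ρ' : Measurable (ρ' ω₂ lam) :=
  (continuous_ρ ω₂ lam).measurable.real_toNNReal

theorem lintegral_ρ'_lt_top (hω : 0 < ω₂) (hl : 0 ≤ lam) :
    ∫⁻ x, (ρ' ω₂ lam x : ENNReal) < ⊤ := by
  have h := (integrable_ρ ω₂ lam hω hl).hasFiniteIntegral
  rw [hasFiniteIntegral_iff_norm] at h
  refine lt_of_le_of_lt (le_of_eq ?_) h
  refine lintegral_congr fun x => ?_
  rw [Real.norm_eq_abs, abs_of_pos (ρ_pos ω₂ lam x)]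
  rfl

theorem volume_univ_phaseSpace_one : (volume : Measure (PhaseSpace 1)) univ = ⊤ := by
  rw [← measurePreserving_E.measure_preimage MeasurableSet.univ.nullMeasurableSet, preimage_univ,
    Measure.volume_eq_prod, ← univ_prod_univ, Measure.prod_prod]
  simp

theorem lintegral_ρ'_ne_zero : ∫⁻ x, (ρ' ω₂ lam x : ENNReal) ≠ 0 := by
  intro h0
  have hae := (lintegral_eq_zero_iff (measurable_ρ' ω₂ lam).coe_nnreal_ennreal).1 h0
  have hzero : (volume : Measure (PhaseSpace 1)) {x | (ρ' ω₂ lam x : ENNReal) ≠ 0} = 0 := by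
    have := ae_iff.1 hae
    simpa using this
  have hset : {x : PhaseSpace 1 | (ρ' ω₂ lam x : ENNReal) ≠ 0} = univ := by
    ext x
    simp [ρ', ρ_pos ω₂ lam x]
  rw [hset, volume_univ_phaseSpace_one] at hzero
  exact ENNReal.top_ne_zero hzero

/-- the normalised Gibbs-type measure `Z⁻¹ e^{-H} dq dp` of the one-site chain -/
def μG (ω₂ lam : ℝ) : Measure (PhaseSpace 1) :=
  (∫⁻ x, (ρ' ω₂ lam x : ENNReal))⁻¹ • volume.withDensity (fun x => ρ' ω₂ lam x)

theorem isProbabilityMeasure_μG (hω : 0 < ω₂) (hl : 0 ≤ lam) : IsProbabilityMeasure (μG ω₂ lam) := by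
  constructor
  rw [μG, Measure.smul_apply, withDensity_apply _ MeasurableSet.univ, Measure.restrict_univ,
    smul_eq_mul]
  exact ENNReal.inv_mul_cancel (lintegral_ρ'_ne_zero ω₂ lam) (lintegral_ρ'_lt_top ω₂ lam hω hl).ne

theorem integral_μG (g : PhaseSpace 1 → ℝ) :
    ∫ x, g x ∂(μG ω₂ lam) =
      ((∫⁻ x, (ρ' ω₂ lam x : ENNReal))⁻¹).toReal * ∫ x, g x * ρ ω₂ lam x ∂volume := by
  rw [μG, integral_smul_measure, integral_withDensity_eq_integral_smul (measurable_ρ' ω₂ lam)]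
  simp only [smul_eq_mul]
  congr 1
  refine integral_congr_ae (Eventually.of_forall fun x => ?_)
  show ρ' ω₂ lam x • g x = g x * ρ ω₂ lam x
  rw [NNReal.smul_def, coe_ρ', smul_eq_mul, mul_comm]

theorem μG_singleton (z : PhaseSpace 1) : μG ω₂ lam {z} = 0 := by
  rw [μG, Measure.smul_apply, smul_eq_mul]
  have hvol : (volume : Measure (PhaseSpace 1)) {z} = 0 := by
    rw [Measure.volume_eq_prod]
    exact measure_singleton z
  have : volume.withDensity (fun x => (ρ' ω₂ lam x : ENNReal)) {z} = 0 :=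
    withDensity_absolutelyContinuous _ _ hvol
  rw [this, mul_zero]

theorem bondCurrent_one (P : OscillatorChain) (i : Fin 1) (x : PhaseSpace 1) : P.bondCurrent 1 i x = 0 := by
  simp [OscillatorChain.bondCurrent]

/-- **Second steady state at `γ = 0`**: the Gibbs-type measure is a weak steady state of the
isolated one-site chain at every pair of bath temperatures. -/
theorem isSteadyState_μG (hω : 0 < ω₂) (hl : 0 ≤ lam) (T_L T_R : ℝ) :
    (P₀ ω₂ lam β).IsSteadyState 1 T_L T_R (μG ω₂ lam) := by
  unfold OscillatorChain.IsSteadyState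
  refine ⟨isProbabilityMeasure_μG ω₂ lam hω hl, fun f hf hfs => ?_, fun i => ?_⟩
  · rw [integral_μG, integral_generator_mul_ρ ω₂ lam β T_L T_R f hf hfs, mul_zero]
  · have : (P₀ ω₂ lam β).bondCurrent 1 i = fun _ => 0 := funext (bondCurrent_one _ i)
    rw [this]
    exact integrable_zero _ _ _

end OneSite

/-- **`Uniq` FAILS AT `γ = 0`** (`ω₂ > 0`, `lam ≥ 0`, any `β`): the isolated one-site chain has two
distinct weak steady states at every pair of bath temperatures — `δ_0` (`isSteadyState_dirac_origin`)
and `Z⁻¹ e^{-H} dq dp` (`OneSite.isSteadyState_μG`). So the uniqueness hypothesis of the crux is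
exactly what absorbs the bath coupling: it is false where the baths are switched off. (Also negative
knowledge for `NessUnique`, stmt-0741: `0 < γ` cannot be dropped there.) -/
theorem not_uniq_gamma_zero {ω₂ lam : ℝ} (β : ℝ) (hω : 0 < ω₂) (hl : 0 ≤ lam) :
    ¬ Uniq ω₂ lam β 0 := by
  intro hU
  have h := hU 1 1 1 one_pos one_pos (Measure.dirac 0) (OneSite.μG ω₂ lam)
    (isSteadyState_dirac_origin ω₂ lam β 1 1 1) (OneSite.isSteadyState_μG ω₂ lam β hω hl 1 1)
  have h1 : (Measure.dirac (0 : PhaseSpace 1)) {0} = 1 := Measure.dirac_apply_of_mem rfl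
  rw [h, OneSite.μG_singleton] at h1
  exact zero_ne_one h1

/-- Hence the `γ ≥ 0` extension of the crux HOLDS at `γ = 0` — vacuously, through the failure of
`Uniq` (compare `cruxShape_gamma_zero_iff`: were `Uniq` true there, the extension would assert that
the conjunct's own chain has no Abelian Green–Kubo witness at any temperature). -/
theorem cruxShape_gamma_zero {ω₂ lam : ℝ} (β : ℝ) (hω : 0 < ω₂) (hl : 0 ≤ lam) :
    CruxShape ω₂ lam β 0 :=
  fun hU => absurd hU (not_uniq_gamma_zero β hω hl)

/-! ### §2b The guard `0 < T` -/

/-- **`0 < T` IS LOAD-BEARING (conclusion side).** For `T ≤ 0` the conclusion shape fails for every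
`κ ≠ 0` as soon as ONE steady family exists: the temperatures `T ± δ/2` are never both positive, so
the family may be the origin Dirac mass there, with zero response. (On the hypothesis side there is
no Gibbs state at `T ≤ 0` either — `not_isChainGibbsMeasure_of_nonpos` below — so the crux is
consistent; the point is that nothing can be said "uniformly down to `T = 0`".) -/
theorem tlconv_false_of_nonpos {ω₂ lam β γ T κ : ℝ} (hT : T ≤ 0) (hκ : κ ≠ 0)
    (hex : ∃ μ₀ : (N : ℕ) → ℝ → ℝ → Measure (PhaseSpace N), IsSteadyFamily ω₂ lam β γ μ₀) :
    ¬ TLconv ω₂ lam β γ T κ := by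
  classical
  intro hTL
  obtain ⟨μ₀, hμ₀⟩ := hex
  let μ : (N : ℕ) → ℝ → ℝ → Measure (PhaseSpace N) := fun N a b =>
    if 0 < a ∧ 0 < b then μ₀ N a b else Measure.dirac 0
  have hμ : IsSteadyFamily ω₂ lam β γ μ := by
    intro N a b ha hb
    simp only [μ, if_pos (And.intro ha hb)]
    exact hμ₀ N a b ha hb
  have h0 : IsResponse ω₂ lam β γ T μ (fun _ => 0) := by
    refine isResponse_zero_of_dirac fun N δ _ => ?_
    have : ¬ (0 < T + δ / 2 ∧ 0 < T - δ / 2) := fun h => by linarith [h.1, h.2]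
    simp only [μ, if_neg this]
  exact hκ (kappa_eq_zero_of_tlconv hTL hμ h0)

/-- The instance for the conjunct's chain (steady families exist by the PROVED
`pinnedChain_exists_isSteadyState`, CEHR 2018 Thm 2.13 + `N = 0`). -/
theorem tlconv_false_of_nonpos_pinnedChain {ω₂ lam β γ T κ : ℝ} (hω : 0 < ω₂) (hl : 0 < lam)
    (hβ : 0 < β) (hγ : 0 < γ) (hT : T ≤ 0) (hκ : κ ≠ 0) : ¬ TLconv ω₂ lam β γ T κ := by
  classical
  refine tlconv_false_of_nonpos hT hκ ?_
  refine ⟨fun N a b => if h : 0 < a ∧ 0 < b then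
      (pinnedChain_exists_isSteadyState hω hl hβ hγ N h.1 h.2).choose else Measure.dirac 0, ?_⟩
  intro N a b ha hb
  simp only [dif_pos (And.intro ha hb)]
  exact (pinnedChain_exists_isSteadyState hω hl hβ hγ N ha hb).choose_spec


/-! #### Hypothesis side of the guard: no Gibbs state at `T ≤ 0` -/

section NoGibbs
open Literature.Probability.LatticeModels (hamiltonianIn glueWith measurable_glueWith
  gibbsSpecOfPotential)

/-- The chain potential of `pinnedChain` is termwise non-negative (`ω₂, lam, β ≥ 0`). -/
theorem chainPotential_nonneg {ω₂ lam β : ℝ} (γ : ℝ) (hω : 0 ≤ ω₂) (hl : 0 ≤ lam) (hβ : 0 ≤ β)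
    (A : Finset ℤ) (σ : ChainConfig) : 0 ≤ (pinnedChain ω₂ lam β γ).chainPotential A σ := by
  unfold OscillatorChain.chainPotential
  refine add_nonneg (Finset.sum_nonneg fun x _ => ?_) (Finset.sum_nonneg fun x _ => ?_)
  · split_ifs
    · simp only [pinnedChain]
      have h1 : 0 ≤ ω₂ * (σ x).1 ^ 2 / 2 := by positivity
      have h2 : 0 ≤ lam * (σ x).1 ^ 4 / 4 := by positivity
      have h3 : 0 ≤ (σ x).2 ^ 2 / 2 := by positivity
      linarith
    · exact le_rfl
  · split_ifs
    · simp only [pinnedChain]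
      have h1 : 0 ≤ ((σ (x + 1)).1 - (σ x).1) ^ 2 / 2 := by positivity
      have h2 : 0 ≤ β * ((σ (x + 1)).1 - (σ x).1) ^ 4 / 4 := by positivity
      linarith
    · exact le_rfl

theorem hamiltonianIn_nonneg {ω₂ lam β : ℝ} (γ : ℝ) (hω : 0 ≤ ω₂) (hl : 0 ≤ lam) (hβ : 0 ≤ β)
    (Λ : Finset ℤ) (σ : ChainConfig) :
    0 ≤ hamiltonianIn (pinnedChain ω₂ lam β γ).chainPotential OscillatorChain.chainSupp Λ σ := by
  classical
  unfold hamiltonianIn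
  exact Finset.sum_nonneg fun A _ => chainPotential_nonneg γ hω hl hβ A σ

/-- Lebesgue measure of the plane is infinite. -/
theorem volume_univ_real_prod : (volume : Measure (ℝ × ℝ)) univ = ⊤ := by
  rw [Measure.volume_eq_prod, ← univ_prod_univ, Measure.prod_prod]
  simp

/-- The a priori measure of a nonempty volume is infinite, hence not finite. -/
theorem not_isFiniteMeasure_apriori (Λ : Finset ℤ) (hΛ : Λ.Nonempty) (η : ChainConfig) :
    ¬ IsFiniteMeasure ((Measure.pi fun _ : Λ => (volume : Measure (ℝ × ℝ))).map (glueWith Λ · η)) := by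
  intro hfin
  have h := measure_lt_top ((Measure.pi fun _ : Λ => (volume : Measure (ℝ × ℝ))).map (glueWith Λ · η)) univ
  rw [Measure.map_apply (measurable_glueWith Λ η) MeasurableSet.univ, preimage_univ, Measure.pi_univ] at h
  simp only [volume_univ_real_prod, Finset.prod_const, Finset.card_univ] at h
  have hcard : Fintype.card {x // x ∈ Λ} ≠ 0 := by
    rw [Fintype.card_coe]; exact (Finset.card_pos.2 hΛ).ne'
  rw [ENNReal.top_pow hcard] at h
  exact lt_irrefl _ h

/-- **No Gibbs state at non-positive temperature** (hypothesis side of the `0 < T` guard). For `T ≤ 0` (and `ω₂, lam, β ≥ 0`) every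
finite-volume kernel of `chainSpecification T` in a nonempty volume is the ZERO measure
(`Measure.tilted` of the non-normalisable density `exp(-T⁻¹ H_Λ) ≥ 1` against an infinite a priori
measure), so the DLR equation in the volume `{0}` reads `0 = μ(univ) = 1`. -/
theorem not_isChainGibbsMeasure_of_nonpos {ω₂ lam β T : ℝ} (γ : ℝ) (hω : 0 ≤ ω₂) (hl : 0 ≤ lam)
    (hβ : 0 ≤ β) (hT : T ≤ 0) (μ : Measure ChainConfig) :
    ¬ (pinnedChain ω₂ lam β γ).IsChainGibbsMeasure T μ := by
  classical
  intro hG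
  set Λ : Finset ℤ := {0} with hΛ
  have hker : ∀ η : ChainConfig, (pinnedChain ω₂ lam β γ).chainSpecification T Λ η = 0 := by
    intro η
    unfold OscillatorChain.chainSpecification gibbsSpecOfPotential
    refine tilted_of_not_integrable fun hint => ?_
    -- `exp(-T⁻¹ H) ≥ 1`, so the constant `1` would be integrable against an infinite measure
    have h1 : Integrable (fun _ : ChainConfig => (1 : ℝ))
        ((Measure.pi fun _ : Λ => (volume : Measure (ℝ × ℝ))).map (glueWith Λ · η)) := by
      refine hint.mono' aestronglyMeasurable_const (Eventually.of_forall fun σ => ?_)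
      rw [norm_one]
      apply Real.one_le_exp
      have hH := hamiltonianIn_nonneg γ hω hl hβ Λ σ
      have hTinv : -T⁻¹ ≥ 0 := by
        have : T⁻¹ ≤ 0 := inv_nonpos.2 hT
        linarith
      exact mul_nonneg hTinv hH
    rw [integrable_const_iff] at h1
    rcases h1 with h1 | h1
    · exact one_ne_zero h1
    · exact not_isFiniteMeasure_apriori Λ (by simp [hΛ]) η h1
  have hDLR := hG.2 Λ univ MeasurableSet.univ
  simp only [hker, Measure.coe_zero, Pi.zero_apply, lintegral_zero] at hDLR
  haveI := hG.1
  rw [measure_univ] at hDLR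
  exact zero_ne_one hDLR


/-- Hence at `T ≤ 0` the HYPOTHESIS of the crux is false as well (a witness carries a Gibbs state):
the guard `0 < T` is harmless bookkeeping — both sides of the crux are dead below it — unlike
`0 < γ`, whose removal kills only the conclusion. -/
theorem no_witness_of_nonpos {ω₂ lam β T : ℝ} (γ : ℝ) (hω : 0 ≤ ω₂) (hl : 0 ≤ lam) (hβ : 0 ≤ β)
    (hT : T ≤ 0) :
    ¬ ∃ (μT : Measure ChainConfig) (D : InfiniteChainDynamics (pinnedChain ω₂ lam β γ)) (κ : ℝ),
        Witness ω₂ lam β γ T μT D κ :=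
  fun ⟨μT, _, _, hW⟩ => not_isChainGibbsMeasure_of_nonpos γ hω hl hβ hT μT hW.1

end NoGibbs

/-! ### §2c Anharmonicity `lam, β > 0`: the harmonic corner -/

/-- **`lam, β > 0` ARE LOAD-BEARING (conclusion side), unconditionally.** For the pinned HARMONIC
chain (`lam = β = 0`) the conclusion shape fails for EVERY `κ` at every `T > 0`: along the
Rieder–Lebowitz–Lieb steady family (PROVED fact `HarmonicChainBallisticFlux_holds`) the response
sequence is `D_{M+1} = M c_{M+1} → +∞`. -/
theorem tlconv_harmonic_false {ω₂ γ T : ℝ} (hω : 0 < ω₂) (hγ : 0 < γ) (hT : 0 < T) (κ : ℝ) :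
    ¬ TLconv ω₂ 0 0 γ T κ := by
  intro hTL
  obtain ⟨μ, hμ, c, cinf, -, hresp, -, hup⟩ :=
    HarmonicChainBallisticFlux.ballisticLaw HarmonicChainBallisticFlux_holds hω hγ
  let Dn : ℕ → ℝ := fun N => Nat.casesOn N 0 fun M => (M : ℝ) * c (M + 1)
  have hD : IsResponse ω₂ 0 0 γ T μ Dn := by
    intro N
    cases N with
    | zero =>
      show Tendsto (fun δ : ℝ => (pinnedChain ω₂ 0 0 γ).totalCurrent (μ 0 (T + δ / 2) (T - δ / 2)) / δ)
        (𝓝[≠] 0) (𝓝 0)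
      have h : Tendsto (fun _ : ℝ => (0 : ℝ)) (𝓝[≠] (0 : ℝ)) (𝓝 (0 : ℝ)) := tendsto_const_nhds
      simpa only [OscillatorChain.totalCurrent_zero, zero_div] using h
    | succ M => exact hresp T hT M
  have hlim : Tendsto (fun M : ℕ => Dn (M + 1)) atTop (𝓝 κ) :=
    (hTL μ hμ Dn hD).comp (tendsto_add_atTop_nat 1)
  exact (hlim.not_tendsto (disjoint_nhds_atTop κ)) hup

/-- Hence the `lam, β ≥ 0` extension of the crux is, at the harmonic corner, EQUIVALENT to:
"uniqueness for the harmonic chain implies that the harmonic chain has NO finite positive Abelian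
Green–Kubo limit at any `T > 0`" — true (ballistic: `C_T(t) ↛ 0`, Abel integral `≍ 1/ν`), but a
statement about the non-existence of the witness, not about thermodynamic limits. Same pattern as
`γ = 0`: every corner that kills the conclusion kills a hypothesis. -/
theorem cruxShape_harmonic_iff {ω₂ γ : ℝ} (hω : 0 < ω₂) (hγ : 0 < γ) :
    CruxShape ω₂ 0 0 γ ↔
      (Uniq ω₂ 0 0 γ → ∀ T : ℝ, 0 < T →
        ¬ ∃ (μT : Measure ChainConfig) (D : InfiniteChainDynamics (pinnedChain ω₂ 0 0 γ)) (κ : ℝ),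
            Witness ω₂ 0 0 γ T μT D κ) := by
  constructor
  · intro h hU T hT hex
    obtain ⟨μT, D, κ, -, hTL⟩ := h hU T hT hex
    exact tlconv_harmonic_false hω hγ hT κ hTL
  · intro h hU T hT hex
    exact absurd hex (h hU T hT)

/-! ## §3 Barrier reduction: the crux entails the `N`-uniform bound nobody has -/

/-- **BARRIER REDUCTION** (`Literature/Barriers/AtomisticToContinuum/FixedLengthNoConductivityControl`).
If the crux holds, then for every admissible chain with weak-NESS uniqueness and Abelian Green–Kubo
witnesses at all `T > 0` (the route's `NessUnique`, `DrudeDissolution → … → GreenKuboContinuation`),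
the finite-size conductivities are bounded uniformly in `N` — `HasBoundedResponse`, the statement
the barrier entry records as obtained for NO deterministic anharmonic bulk (BLR 2000 §6.3 "Nothing
is known about the dependence of `D` on `L`"; reaffirmed 2009–2026). So a proof of the crux is, in
particular, the first `N`-uniform bound on `κ_N` for a Hamiltonian chain; the Abelian regularisation
does not soften this. -/
theorem hasBoundedResponse_of_crux (h : Theses.EmbeddedDrudeMourre.AbelThermodynamicLimit)
    {ω₂ lam β γ : ℝ} (hω : 0 < ω₂) (hl : 0 < lam) (hβ : 0 < β) (hγ : 0 < γ)
    (hU : Uniq ω₂ lam β γ)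
    (hW : ∀ T : ℝ, 0 < T → ∃ (μT : Measure ChainConfig)
      (D : InfiniteChainDynamics (pinnedChain ω₂ lam β γ)) (κ : ℝ), Witness ω₂ lam β γ T μT D κ) :
    HasBoundedResponse (pinnedChain ω₂ lam β γ) := by
  intro μ hμ T hT Dn hD
  obtain ⟨μT, D, κ, -, hTL⟩ := (crux_iff.1 h) ω₂ lam β γ hω hl hβ hγ hU T hT (hW T hT)
  exact ((continuous_abs.tendsto _).comp (hTL μ hμ Dn hD)).bddAbove_range

/-! ## §4 Why the crux resists disproof (record) -/

/-- `resists` — a `True` carrier for the record (read the docstring).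

A refutation `¬ AbelThermodynamicLimit` must produce an admissible point `(ω₂, lam, β, γ) > 0` with
(1) `Uniq` PROVED there (= item stmt-0741: CEHR 2018 Thm 2.13 uniqueness of the invariant measure +
identification of weak Fokker–Planck solutions; not in the tree, `N = 1` already needs hypoelliptic
OU uniqueness), (2) an Abelian witness PROVED to exist at some `T > 0` (= the Green–Kubo half of the
route: infinite-volume dynamics preserving a DLR state with summable correlations and a positive
finite Abel limit — the tree has the Buttà–Marchioro dynamics only as a named fact and no invariance
theorem), and (3) a steady family with response limits at all `N` (item 0717) whose canonical `Dn`
provably does NOT tend to the `κ` of ANY witness — i.e. a theorem that Fourier's law fails, or that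
`lim κ_N ≠ κ_GK^{Abel}`, for the pinned quartic chain. (3) contradicts the physics consensus
(open-vs-closed Green–Kubo agree for diffusive momentum-non-conserving chains: Kundu–Dhar–Narayan
2009; proved equal for conservative-noise bulks: Bernardin–Olla 2005; and it is the unstated working
hypothesis of the kinetic-theory tests: Aoki–Lukkarinen–Spohn 2006 DEFINE `κ(T)` by the closed-chain
Green–Kubo formula, their (2.6)–(2.7), and MEASURE it by boundary-thermostatted non-equilibrium MD
with Fourier fits, §5, the `O(1)` boundary temperature jumps scaling out of the bulk current,
(6.18)–(6.22) — read at page level, arXiv:cond-mat/0602082) and (1)–(2) are themselves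
open formalisation targets. Junk models do not help: `InfiniteChainDynamics` with empty carrier
forces `μT = 0` under `PreservesMeasure` (not a probability measure), a constant flow forces `μT` to
be carried by equilibria (`δ_0`, not DLR since the one-site kernel is Lebesgue-absolutely
continuous), and on a carrier of full `μT`-measure the flow must solve the true equations; on the
finite side `IsSteadyState` has no Bochner junk for `C_c^∞` test functions. Every degenerate corner
that falsifies the conclusion (`γ = 0`: §2a; `lam = β = 0`: §2c; `T ≤ 0`: §2b) simultaneously
falsifies a hypothesis (`Uniq`, resp. the witness, resp. both). Verdict of this cycle: not refutable
by cheap means; probably true; its proof = BLR's open `κ = κ_GK` in Abelian form PLUS an `N`-uniform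
`κ_N` bound (§3).

PROOF SKELETON SUGGESTED BY THE LOAD-BEARING ANALYSIS (where each hypothesis must enter).
(1) OPEN-CHAIN ABEL–KUBO IDENTITY at fixed `N` — the only place `0 < γ` and `Uniq` can act (§2a):
`D_N(T) = T⁻² lim_{ν↓0} ∫₀^∞ e^{-νt} C_N^{open}(t) dt`, `C_N^{open}` the bond-summed current
autocorrelation of the `N`-site chain WITH both baths at temperature `T` (equilibrium, law
`Z⁻¹e^{-H_N/T}`), from the linear response of the unique weak steady state in `δ` (ReyBellet2003
Rem. 4.4 (56), KunduDharNarayan2009; needs hypoelliptic regularity/ergodicity of the equal-temperature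
Langevin chain — `γ > 0`). Not expressible in the tree until the open-chain Markov semigroup is
defined (cf. docstring of `LangevinChainNESS`). (2) BULK/CONTACT DECOMPOSITION at fixed `ν > 0`:
`lim_N (N-1)⁻¹·[Abel transform of C_N^{open}](ν) = [Abel transform of C_∞](ν)` — finite propagation
speed (tree: the almost-linear light cone `ButtaMarchioro2016_thm22_chain`, a named fact in `InfiniteChainLightCone`) + local convergence of the open equilibrium dynamics to `D`
away from the ends; the weight `e^{-νt}` makes times `≫ 1/ν` irrelevant, so only `O(1/ν)` light
cones touch the baths: contact layers are `o(1)` after division by `N - 1`. This is where the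
WITNESS (`PreservesMeasure`, `HasAbsConvergentCorrelation`) enters. (3) EXCHANGE OF LIMITS
`ν ↓ 0` vs `N → ∞` — the genuinely open core: `N`-uniform control of the low-frequency current
spectrum of the OPEN chain (its spectral gap closes with `N`, BeckerMenegaki2022), equivalently an
`N`-uniform bound of the kind §3 shows is unavoidable. A refuter's remark: (3) is exactly what fails
at the harmonic corner (`D_N ∼ N`, §2c) while (1)–(2) survive there, so any argument for (3) must
use `lam, β > 0` quantitatively (cf. barrier `LowTemperatureWeakAnharmonicity`: it must degenerate as
`lamT, βT → 0`). -/
theorem resists : True := trivial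

/-! ## §7 Seat stmt-14013: `LatticeLandauDamping.AbelThermodynamicLimit`, uniqueness discharged, line `SketchIdeator2`

Written by refuter-cdisprove-stmt-AtomisticToContinuum-14013-0 (2026-08-16), EXTENDING the twin seat's §0–§6 (kept
verbatim above).  Everything in this section is sorry-free. -/

namespace Seat14013

/-! ### §7.0 Read-back for the Lattice decl -/

/-- The two cruxes sharing this directory are the same proposition. -/
theorem lattice_eq_sibling :
    Theses.LatticeLandauDamping.AbelThermodynamicLimit = Theses.EmbeddedDrudeMourre.AbelThermodynamicLimit :=
  rfl

/-- The Lattice crux through the §0 shorthand (`Iff.rfl`), so §1–§6 apply to it verbatim. -/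
theorem lattice_crux_iff :
    Theses.LatticeLandauDamping.AbelThermodynamicLimit ↔
      ∀ ω₂ lam β γ : ℝ, 0 < ω₂ → 0 < lam → 0 < β → 0 < γ → CruxShape ω₂ lam β γ :=
  Iff.rfl

/-! ### §7.1 `Uniq` is now a THEOREM: the uniqueness-free crux and the refuter's exact target -/

/-- **`Uniq` discharged** (new since v5): weak-NESS uniqueness for `pinnedChain` at admissible parameters is
PROVED in the tree (`LatticeLandauDamping.NessUnique_holds` ← `Theorems.nessUnique_proof` ← CEHR 2018 Thm 2.13 +
the Fokker–Planck identification, all formalised).  §2a′ (`not_uniq_gamma_zero`) is its exact complement at `γ = 0`. -/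
theorem uniq_holds {ω₂ lam β γ : ℝ} (hω : 0 < ω₂) (hl : 0 < lam) (hβ : 0 < β) (hγ : 0 < γ) :
    Uniq ω₂ lam β γ :=
  Theses.LatticeLandauDamping.NessUnique_holds ω₂ lam β γ hω hl hβ hγ

/-- **The crux is equivalent to its uniqueness-free specialisation** (provers: discharge `hU` by
`NessUnique_holds`; refuters: no uniqueness proof is owed any more). -/
theorem crux_iff_uniqFree :
    Theses.LatticeLandauDamping.AbelThermodynamicLimit ↔
      ∀ ω₂ lam β γ : ℝ, 0 < ω₂ → 0 < lam → 0 < β → 0 < γ → ∀ T : ℝ, 0 < T →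
        (∃ (μT : Measure ChainConfig) (D : InfiniteChainDynamics (pinnedChain ω₂ lam β γ)) (κ : ℝ),
            Witness ω₂ lam β γ T μT D κ) →
        ∃ (μT : Measure ChainConfig) (D : InfiniteChainDynamics (pinnedChain ω₂ lam β γ)) (κ : ℝ),
          Witness ω₂ lam β γ T μT D κ ∧ TLconv ω₂ lam β γ T κ := by
  rw [lattice_crux_iff]
  constructor
  · intro h ω₂ lam β γ hω hl hβ hγ T hT hex
    exact h ω₂ lam β γ hω hl hβ hγ (uniq_holds hω hl hβ hγ) T hT hex
  · intro h ω₂ lam β γ hω hl hβ hγ _ T hT hex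
    exact h ω₂ lam β γ hω hl hβ hγ T hT hex

/-- **THE REFUTER'S EXACT TARGET, 2026-08-16.**  `¬ crux` is equivalent to: at ONE admissible point and ONE `T > 0`,
SOME Abelian Green–Kubo witness exists, and for EVERY witness `(μT, D, κ)` there is a steady family with a response
sequence NOT tending to `κ` — by `response_unique` (§1, `Uniq` now free) the response sequence is canonical, so this
reads: "a witness exists, the canonical response `D_N` exists at every `N`, and `D_N ↛ κ` for every witness-`κ`".
Of the three ingredients of §4, (1) `Uniq` is now PROVED; (2) = the route's own target `AbelGreenKubo` (open) and
(3) = failure of the Abelian Green–Kubo identification for the pinned quartic chain (no print, contradicts the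
consensus) remain. -/
theorem not_crux_iff :
    ¬ Theses.LatticeLandauDamping.AbelThermodynamicLimit ↔
      ∃ ω₂ lam β γ : ℝ, 0 < ω₂ ∧ 0 < lam ∧ 0 < β ∧ 0 < γ ∧ ∃ T : ℝ, 0 < T ∧
        (∃ (μT : Measure ChainConfig) (D : InfiniteChainDynamics (pinnedChain ω₂ lam β γ)) (κ : ℝ),
            Witness ω₂ lam β γ T μT D κ) ∧
        ∀ (μT : Measure ChainConfig) (D : InfiniteChainDynamics (pinnedChain ω₂ lam β γ)) (κ : ℝ),
          Witness ω₂ lam β γ T μT D κ →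
            ∃ μ : (N : ℕ) → ℝ → ℝ → Measure (PhaseSpace N), IsSteadyFamily ω₂ lam β γ μ ∧
              ∃ Dn : ℕ → ℝ, IsResponse ω₂ lam β γ T μ Dn ∧ ¬ Tendsto Dn atTop (𝓝 κ) := by
  rw [crux_iff_uniqFree]
  constructor
  · intro h
    by_contra hcon
    apply h
    intro ω₂ lam β γ hω hl hβ hγ T hT hex
    by_contra hno
    apply hcon
    refine ⟨ω₂, lam, β, γ, hω, hl, hβ, hγ, T, hT, hex, fun μT D κ hW => ?_⟩
    by_contra hfam
    apply hno
    refine ⟨μT, D, κ, hW, fun μ hμ Dn hD => ?_⟩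
    by_contra hlim
    exact hfam ⟨μ, hμ, Dn, hD, hlim⟩
  · rintro ⟨ω₂, lam, β, γ, hω, hl, hβ, hγ, T, hT, hex, hall⟩ h
    obtain ⟨μT, D, κ, hW, hTL⟩ := h ω₂ lam β γ hω hl hβ hγ T hT hex
    obtain ⟨μ, hμ, Dn, hD, hlim⟩ := hall μT D κ hW
    exact hlim (hTL μ hμ Dn hD)

/-- With `Uniq` free, §1's canonical-response theorem needs no hypothesis beyond admissibility. -/
theorem response_unique' {ω₂ lam β γ : ℝ} (hω : 0 < ω₂) (hl : 0 < lam) (hβ : 0 < β) (hγ : 0 < γ)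
    {μ μ' : (N : ℕ) → ℝ → ℝ → Measure (PhaseSpace N)}
    (hμ : IsSteadyFamily ω₂ lam β γ μ) (hμ' : IsSteadyFamily ω₂ lam β γ μ') {T : ℝ} (hT : 0 < T)
    {Dn Dn' : ℕ → ℝ} (hD : IsResponse ω₂ lam β γ T μ Dn) (hD' : IsResponse ω₂ lam β γ T μ' Dn') :
    Dn = Dn' :=
  response_unique (uniq_holds hω hl hβ hγ) hμ hμ' hT hD hD'

/-- **Barrier reduction without `hU`** (§3 sharpened): crux + Abelian witnesses at all `T > 0` ⇒ `HasBoundedResponse`. -/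
theorem hasBoundedResponse_of_crux' (h : Theses.LatticeLandauDamping.AbelThermodynamicLimit)
    {ω₂ lam β γ : ℝ} (hω : 0 < ω₂) (hl : 0 < lam) (hβ : 0 < β) (hγ : 0 < γ)
    (hW : ∀ T : ℝ, 0 < T → ∃ (μT : Measure ChainConfig)
      (D : InfiniteChainDynamics (pinnedChain ω₂ lam β γ)) (κ : ℝ), Witness ω₂ lam β γ T μT D κ) :
    HasBoundedResponse (pinnedChain ω₂ lam β γ) :=
  hasBoundedResponse_of_crux (lattice_eq_sibling ▸ h) hω hl hβ hγ (uniq_holds hω hl hβ hγ) hW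

/-- … and with the route's own target: `AbelThermodynamicLimit ∧ AbelGreenKubo ⇒ HasBoundedResponse` everywhere. -/
theorem hasBoundedResponse_of_crux_of_abelGreenKubo (h : Theses.LatticeLandauDamping.AbelThermodynamicLimit)
    (hGK : Theses.LatticeLandauDamping.AbelGreenKubo)
    {ω₂ lam β γ : ℝ} (hω : 0 < ω₂) (hl : 0 < lam) (hβ : 0 < β) (hγ : 0 < γ) :
    HasBoundedResponse (pinnedChain ω₂ lam β γ) :=
  hasBoundedResponse_of_crux' h hω hl hβ hγ fun T hT => hGK ω₂ lam β γ hω hl hβ hγ T hT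

/-! ### §7.2 Line `SketchIdeator2` (series-law-at-every-laplace-frequency): kill criteria for the stub SET

Abstract real analysis over sequences shaped exactly like the stub signatures (`G N ν` = the current resolvent form
`F_N(ν)`, `R N ν = (N−1)²T²/G N ν`, `g ν` = `Â(ν)`, `G0 N = (N−1)T²D_N` by the landed (K), `L = T²κ`).  Landed copy:
`Theorems/AbelThermodynamicLimit/Negative/SignLawsKillCriteria.lean`. -/

/-- **Fekete at a fixed frequency** (the line's engine; the lead's `RealAnalysis.fekete_fixed_nu`, re-proved here so
that the kill criteria below are self-contained). -/
theorem fekete_fixed_nu (G : ℕ → ℝ → ℝ) (g : ℝ → ℝ) (C ν₀ : ℝ)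
    (hQ : ∀ ν ∈ Ioc (0 : ℝ) ν₀, ∀ N M : ℕ, 2 ≤ N → 2 ≤ M → G N ν + G M ν - C ≤ G (N + M) ν)
    (hlim : ∀ ν ∈ Ioc (0 : ℝ) ν₀, Tendsto (fun N : ℕ => G N ν / N) atTop (𝓝 (g ν))) :
    ∀ ν ∈ Ioc (0 : ℝ) ν₀, ∀ N : ℕ, 2 ≤ N → G N ν ≤ N * g ν + C := by
  intro ν hν N hN
  have hNpos : 0 < N := by omega
  have hNposR : (0 : ℝ) < N := by exact_mod_cast hNpos
  have iter : ∀ k : ℕ, 1 ≤ k → (k : ℝ) * G N ν - ((k : ℝ) - 1) * C ≤ G (k * N) ν := by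
    intro k hk
    induction k with
    | zero => omega
    | succ k ih =>
      rcases Nat.eq_zero_or_pos k with rfl | hkpos
      · simp
      · have ih' := ih hkpos
        have hkN : 2 ≤ k * N := le_trans hN (Nat.le_mul_of_pos_left N hkpos)
        have hq := hQ ν hν (k * N) N hkN hN
        have hcast : ((k + 1 : ℕ) : ℝ) = (k : ℝ) + 1 := by push_cast; ring
        have hidx : (k + 1) * N = k * N + N := by ring
        rw [hidx, hcast]
        linarith
  have hmul : Tendsto (fun k : ℕ => k * N) atTop atTop :=
    tendsto_atTop_atTop.2 fun b => ⟨b, fun k hk => le_trans hk (Nat.le_mul_of_pos_right k hNpos)⟩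
  have hsub : Tendsto (fun k : ℕ => G (k * N) ν / ((k * N : ℕ) : ℝ)) atTop (𝓝 (g ν)) :=
    (hlim ν hν).comp hmul
  have hRHS : Tendsto (fun k : ℕ => (G N ν - C) / N + C / N / (k : ℝ)) atTop
      (𝓝 ((G N ν - C) / N + 0)) :=
    tendsto_const_nhds.add (tendsto_const_div_atTop_nhds_zero_nat (C / N))
  have hlow : ∀ᶠ k : ℕ in atTop,
      (G N ν - C) / N + C / N / (k : ℝ) ≤ G (k * N) ν / ((k * N : ℕ) : ℝ) := by
    filter_upwards [eventually_ge_atTop 1] with k hk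
    have hkposR : (0 : ℝ) < k := by exact_mod_cast hk
    have h := iter k hk
    have e1 : (G N ν - C) / N + C / N / (k : ℝ) =
        ((k : ℝ) * G N ν - ((k : ℝ) - 1) * C) / ((k * N : ℕ) : ℝ) := by
      push_cast
      field_simp
      ring
    rw [e1]
    exact div_le_div_of_nonneg_right h (by positivity)
  have hle : (G N ν - C) / N + 0 ≤ g ν := le_of_tendsto_of_tendsto hRHS hsub hlow
  rw [add_zero, div_le_iff₀ hNposR] at hle
  linarith

/-- **DC shadow**: a sign law valid on a window `(0, ν₀]` passes to the DC values at fixed `N, M` — so QSR implies,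
for the canonical response, the conclusion of `JunctionLocality.SuperadditiveResistance` (stmt-11748) with the same
constant, and every kill of that crux kills QSR. -/
theorem dcShadow_of_freqResolved (R : ℕ → ℝ → ℝ) (R0 : ℕ → ℝ) (C ν₀ : ℝ) (hν₀ : 0 < ν₀)
    (hQ : ∀ ν ∈ Ioc (0 : ℝ) ν₀, ∀ N M : ℕ, 2 ≤ N → 2 ≤ M → R N ν + R M ν - C ≤ R (N + M) ν)
    (hDC : ∀ N : ℕ, 2 ≤ N → Tendsto (R N) (𝓝[>] 0) (𝓝 (R0 N))) :
    ∀ N M : ℕ, 2 ≤ N → 2 ≤ M → R0 N + R0 M - C ≤ R0 (N + M) := by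
  intro N M hN hM
  have hNM : 2 ≤ N + M := by omega
  have hl : Tendsto (fun ν => R N ν + R M ν - C) (𝓝[>] 0) (𝓝 (R0 N + R0 M - C)) :=
    ((hDC N hN).add (hDC M hM)).sub_const C
  refine le_of_tendsto_of_tendsto hl (hDC (N + M) hNM) ?_
  filter_upwards [Ioc_mem_nhdsGT hν₀] with ν hν using hQ ν hν N M hN hM

/-- **QSR inherits the power-law kill of stmt-11748** (landed `not_insertionBounded_of_rpow_correction`):
`(N−1)/D_N = ℓN + a + bN^s`, `b > 0`, `0 < s < 1` (approach from BELOW like `N^{s−1}`) at one admissible point excludes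
the shape of `stub_quasiSuperadditiveResistance` on every window. -/
theorem not_qsrShape_of_rpow_correction (R : ℕ → ℝ → ℝ) (D : ℕ → ℝ) (ℓ a b s : ℝ) (hb : 0 < b)
    (hs0 : 0 < s) (hs1 : s < 1)
    (hR : ∀ N : ℕ, 2 ≤ N → ((N : ℝ) - 1) / D N = ℓ * N + a + b * (N : ℝ) ^ s)
    (hDC : ∀ N : ℕ, 2 ≤ N → Tendsto (R N) (𝓝[>] 0) (𝓝 (((N : ℝ) - 1) / D N))) :
    ¬ ∃ C ν₀ : ℝ, 0 ≤ C ∧ 0 < ν₀ ∧ ∀ ν : ℝ, 0 < ν → ν ≤ ν₀ → ∀ N M : ℕ, 2 ≤ N → 2 ≤ M →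
        R N ν + R M ν - C ≤ R (N + M) ν := by
  rintro ⟨C, ν₀, -, hν₀, hQ⟩
  refine Theorems.SuperadditiveResistance.Negative.not_insertionBounded_of_rpow_correction (D := D) ℓ a b s hb
    hs0 hs1 hR ⟨C, fun N M hN hM => ?_⟩
  have h := dcShadow_of_freqResolved R (fun N => ((N : ℝ) - 1) / D N) C ν₀ hν₀
    (fun ν hν N M hN hM => hQ ν hν.1 hν.2 N M hN hM) hDC N M hN hM
  have e : ((N : ℝ) + (M : ℝ) - 1) / D (N + M) = (((N + M : ℕ) : ℝ) - 1) / D (N + M) := by push_cast; ring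
  rw [e]
  exact h

/-- **Two-sided envelope at every frequency of the window**: QS (constant `C₁`), QSR (constant `C₂ ≥ 0`), matching
`G N ν / N → g ν > 0` and positivity give `N·g ν − (2 + C₂ g ν/T²)·g ν ≤ G N ν ≤ N·g ν + C₁` for all `ν ∈ (0, ν₀]`,
`N ≥ 2`: the finite-size defect `F_N(ν) − N·Â(ν)` is bounded on BOTH sides, uniformly in `N` and — as long as `Â` is
bounded — in `ν`. -/
theorem twoSided_envelope (G : ℕ → ℝ → ℝ) (g : ℝ → ℝ) (C₁ C₂ ν₀ T : ℝ) (hC₂ : 0 ≤ C₂) (hT : 0 < T)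
    (hQS : ∀ ν ∈ Ioc (0 : ℝ) ν₀, ∀ N M : ℕ, 2 ≤ N → 2 ≤ M → G N ν + G M ν - C₁ ≤ G (N + M) ν)
    (hQSR : ∀ ν ∈ Ioc (0 : ℝ) ν₀, ∀ N M : ℕ, 2 ≤ N → 2 ≤ M →
      ((N : ℝ) - 1) ^ 2 * T ^ 2 / G N ν + ((M : ℝ) - 1) ^ 2 * T ^ 2 / G M ν - C₂ ≤
        (((N + M : ℕ) : ℝ) - 1) ^ 2 * T ^ 2 / G (N + M) ν)
    (hlim : ∀ ν ∈ Ioc (0 : ℝ) ν₀, Tendsto (fun N : ℕ => G N ν / N) atTop (𝓝 (g ν)))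
    (hg : ∀ ν ∈ Ioc (0 : ℝ) ν₀, 0 < g ν)
    (hpos : ∀ ν ∈ Ioc (0 : ℝ) ν₀, ∀ N : ℕ, 2 ≤ N → 0 < G N ν) :
    ∀ ν ∈ Ioc (0 : ℝ) ν₀, ∀ N : ℕ, 2 ≤ N →
      N * g ν - (2 + C₂ * g ν / T ^ 2) * g ν ≤ G N ν ∧ G N ν ≤ N * g ν + C₁ := by
  intro ν hν N hN
  refine ⟨?_, fekete_fixed_nu G g C₁ ν₀ hQS hlim ν hν N hN⟩
  have hT2 : (0 : ℝ) < T ^ 2 := by positivity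
  have hgν := hg ν hν
  have hρlim : ∀ ν' ∈ Ioc (0 : ℝ) ν₀,
      Tendsto (fun N : ℕ => ((N : ℝ) - 1) ^ 2 * T ^ 2 / G N ν' / N) atTop (𝓝 (T ^ 2 / g ν')) := by
    intro ν' hν'
    have hK : g ν' ≠ 0 := (hg ν' hν').ne'
    have h1 : Tendsto (fun N : ℕ => (1 : ℝ) - 1 / (N : ℝ)) atTop (𝓝 (1 - 0)) :=
      tendsto_const_nhds.sub tendsto_one_div_atTop_nhds_zero_nat
    rw [sub_zero] at h1
    have h2 : Tendsto (fun N : ℕ => T ^ 2 * ((1 : ℝ) - 1 / (N : ℝ)) ^ 2 * (G N ν' / N)⁻¹) atTop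
        (𝓝 (T ^ 2 * 1 ^ 2 * (g ν')⁻¹)) :=
      ((h1.pow 2).const_mul (T ^ 2)).mul ((hlim ν' hν').inv₀ hK)
    rw [one_pow, mul_one, ← div_eq_mul_inv] at h2
    refine h2.congr' ?_
    filter_upwards [eventually_ge_atTop 2] with N hN2
    have hN0 : (N : ℝ) ≠ 0 := by positivity
    have hG0 : G N ν' ≠ 0 := (hpos ν' hν' N hN2).ne'
    field_simp
  have hkey : ((N : ℝ) - 1) ^ 2 * T ^ 2 / G N ν ≤ N * (T ^ 2 / g ν) + C₂ :=
    fekete_fixed_nu (fun N ν => ((N : ℝ) - 1) ^ 2 * T ^ 2 / G N ν) (fun ν => T ^ 2 / g ν) C₂ ν₀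
      hQSR hρlim ν hν N hN
  have hGpos := hpos ν hν N hN
  have hN2 : (2 : ℝ) ≤ N := by exact_mod_cast hN
  rw [div_le_iff₀ hGpos] at hkey
  have h1 : ((N : ℝ) - 1) ^ 2 * g ν ≤ ((N : ℝ) + C₂ * g ν / T ^ 2) * G N ν := by
    have e : ((N : ℝ) * (T ^ 2 / g ν) + C₂) * G N ν * g ν = ((N : ℝ) + C₂ * g ν / T ^ 2) * G N ν * T ^ 2 := by
      field_simp
    have := mul_le_mul_of_nonneg_right hkey hgν.le
    rw [e] at this
    have h' : ((N : ℝ) - 1) ^ 2 * T ^ 2 * g ν = ((N : ℝ) - 1) ^ 2 * g ν * T ^ 2 := by ring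
    rw [h'] at this
    exact le_of_mul_le_mul_right this hT2
  have hA : 0 < (N : ℝ) + C₂ * g ν / T ^ 2 := by positivity
  have h2 : ((N : ℝ) + C₂ * g ν / T ^ 2) * (((N : ℝ) - (2 + C₂ * g ν / T ^ 2)) * g ν) ≤
      ((N : ℝ) + C₂ * g ν / T ^ 2) * G N ν := by
    refine le_trans ?_ h1
    have hsq : 0 ≤ (1 + C₂ * g ν / T ^ 2) ^ 2 * g ν := by positivity
    nlinarith [hsq]
  have h3 := le_of_mul_le_mul_left h2 hA
  linarith [h3]

/-- **The two-sided DC law the line secretly proves.**  Adding the DC limits `G N ν → G0 N` and `g ν → L`: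
`N·L − (2 + C₂L/T²)·L ≤ G0 N ≤ N·L + C₁` for every `N ≥ 2`; with `G0 N = (N−1)T²D_N` and `L = T²κ`:
`|(N−1)D_N − Nκ| ≤ C/T²`, i.e. the RATE `D_N = κ + O(1/N)` from both sides.  One admissible point where `κ_N`
approaches `κ` more slowly — from above or from below — kills QS ∧ QSR (given S3, POS, (K), the witness).  Print
records `O(1/N)` only as the boundary-jump phenomenology of the `φ⁴` chain (Aoki–Kusnezov 2002); no slower law is
in print for a pinned doubly-anharmonic chain, and none faster is proved. -/
theorem twoSided_dc_law (G : ℕ → ℝ → ℝ) (G0 : ℕ → ℝ) (g : ℝ → ℝ) (C₁ C₂ ν₀ T L : ℝ) (hC₂ : 0 ≤ C₂)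
    (hT : 0 < T) (hν₀ : 0 < ν₀)
    (hQS : ∀ ν ∈ Ioc (0 : ℝ) ν₀, ∀ N M : ℕ, 2 ≤ N → 2 ≤ M → G N ν + G M ν - C₁ ≤ G (N + M) ν)
    (hQSR : ∀ ν ∈ Ioc (0 : ℝ) ν₀, ∀ N M : ℕ, 2 ≤ N → 2 ≤ M →
      ((N : ℝ) - 1) ^ 2 * T ^ 2 / G N ν + ((M : ℝ) - 1) ^ 2 * T ^ 2 / G M ν - C₂ ≤
        (((N + M : ℕ) : ℝ) - 1) ^ 2 * T ^ 2 / G (N + M) ν)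
    (hlim : ∀ ν ∈ Ioc (0 : ℝ) ν₀, Tendsto (fun N : ℕ => G N ν / N) atTop (𝓝 (g ν)))
    (hg : ∀ ν ∈ Ioc (0 : ℝ) ν₀, 0 < g ν)
    (hpos : ∀ ν ∈ Ioc (0 : ℝ) ν₀, ∀ N : ℕ, 2 ≤ N → 0 < G N ν)
    (hgL : Tendsto g (𝓝[>] 0) (𝓝 L))
    (hDC : ∀ N : ℕ, 2 ≤ N → Tendsto (G N) (𝓝[>] 0) (𝓝 (G0 N))) :
    ∀ N : ℕ, 2 ≤ N → N * L - (2 + C₂ * L / T ^ 2) * L ≤ G0 N ∧ G0 N ≤ N * L + C₁ := by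
  intro N hN
  have henv := twoSided_envelope G g C₁ C₂ ν₀ T hC₂ hT hQS hQSR hlim hg hpos
  have hev : ∀ᶠ ν in 𝓝[>] (0 : ℝ), ν ∈ Ioc (0 : ℝ) ν₀ := Ioc_mem_nhdsGT hν₀
  constructor
  · have hlow : Tendsto (fun ν => (N : ℝ) * g ν - (2 + C₂ * g ν / T ^ 2) * g ν) (𝓝[>] 0)
        (𝓝 ((N : ℝ) * L - (2 + C₂ * L / T ^ 2) * L)) :=
      (hgL.const_mul _).sub ((tendsto_const_nhds.add ((hgL.const_mul C₂).div_const _)).mul hgL)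
    exact le_of_tendsto_of_tendsto hlow (hDC N hN) (hev.mono fun ν hν => (henv ν hν N hN).1)
  · have hup : Tendsto (fun ν => (N : ℝ) * g ν + C₁) (𝓝[>] 0) (𝓝 ((N : ℝ) * L + C₁)) :=
      (hgL.const_mul _).add_const C₁
    exact le_of_tendsto_of_tendsto (hDC N hN) hup (hev.mono fun ν hν => (henv ν hν N hN).2)

/-- **Kill criterion for QS — the side the resistance crux cannot see** (`insertionBounded_of_subadditive_dip`,
stmt-11748, shows the resistance law tolerates any slow approach from ABOVE): `G0 N − N·L → +∞` (i.e.
`(N−1)(D_N − κ) → +∞`: overshoot, or approach from above slower than `1/N`) excludes the shape of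
`stub_quasiSuperadditivity` on every window, given the matching and the DC limits. -/
theorem not_qsShape_of_excess_from_above (G : ℕ → ℝ → ℝ) (G0 : ℕ → ℝ) (g : ℝ → ℝ) (L : ℝ)
    (hlimN : ∀ ν : ℝ, 0 < ν → Tendsto (fun N : ℕ => G N ν / N) atTop (𝓝 (g ν)))
    (hgL : Tendsto g (𝓝[>] 0) (𝓝 L))
    (hDC : ∀ N : ℕ, 2 ≤ N → Tendsto (G N) (𝓝[>] 0) (𝓝 (G0 N)))
    (hexcess : Tendsto (fun N : ℕ => G0 N - N * L) atTop atTop) :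
    ¬ ∃ C ν₀ : ℝ, 0 ≤ C ∧ 0 < ν₀ ∧ ∀ ν : ℝ, 0 < ν → ν ≤ ν₀ → ∀ N M : ℕ, 2 ≤ N → 2 ≤ M →
        G N ν + G M ν - C ≤ G (N + M) ν := by
  rintro ⟨C, ν₀, -, hν₀, hQ⟩
  have hfek := fekete_fixed_nu G g C ν₀ (fun ν hν N M hN hM => hQ ν hν.1 hν.2 N M hN hM)
    (fun ν hν => hlimN ν hν.1)
  have hDCle : ∀ N : ℕ, 2 ≤ N → G0 N ≤ N * L + C := by
    intro N hN
    have hup : Tendsto (fun ν => (N : ℝ) * g ν + C) (𝓝[>] 0) (𝓝 ((N : ℝ) * L + C)) :=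
      (hgL.const_mul _).add_const C
    have hev : ∀ᶠ ν in 𝓝[>] (0 : ℝ), ν ∈ Ioc (0 : ℝ) ν₀ := Ioc_mem_nhdsGT hν₀
    exact le_of_tendsto_of_tendsto (hDC N hN) hup (hev.mono fun ν hν => hfek ν hν N hN)
  obtain ⟨N₀, hN₀⟩ := (tendsto_atTop_atTop.mp hexcess) (C + 1)
  have h1 := hN₀ (max N₀ 2) (le_max_left _ _)
  have h2 := hDCle (max N₀ 2) (le_max_right _ _)
  linarith

/-- **S3 pins `κ` across regular witnesses**: the same finite-chain data `F N ν / N` cannot converge to the Abel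
transforms of two witnesses with different `κ`.  (The ∀-witness content hidden in the matching stub; forced anyway by
`tlconv_kappa_unique` once a response sequence exists, §1.) -/
theorem matching_pins_kappa (F : ℕ → ℝ → ℝ) (A₁ A₂ : ℝ → ℝ) (T κ₁ κ₂ : ℝ)
    (h₁ : ∀ ν : ℝ, 0 < ν → Tendsto (fun N : ℕ => F N ν / N) atTop (𝓝 (A₁ ν)))
    (h₂ : ∀ ν : ℝ, 0 < ν → Tendsto (fun N : ℕ => F N ν / N) atTop (𝓝 (A₂ ν)))
    (hκ₁ : Tendsto (fun ν => (T ^ 2)⁻¹ * A₁ ν) (𝓝[>] 0) (𝓝 κ₁))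
    (hκ₂ : Tendsto (fun ν => (T ^ 2)⁻¹ * A₂ ν) (𝓝[>] 0) (𝓝 κ₂)) : κ₁ = κ₂ := by
  have hA : ∀ ν : ℝ, 0 < ν → A₁ ν = A₂ ν := fun ν hν => tendsto_nhds_unique (h₁ ν hν) (h₂ ν hν)
  have heq : (fun ν => (T ^ 2)⁻¹ * A₁ ν) =ᶠ[𝓝[>] (0 : ℝ)] fun ν => (T ^ 2)⁻¹ * A₂ ν := by
    filter_upwards [self_mem_nhdsWithin] with ν hν
    rw [hA ν hν]
  exact tendsto_nhds_unique (hκ₁.congr' heq) hκ₂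

/-! ### §7.3 Verdict on the line and what would kill it (record) -/

/-- `line_SketchIdeator2_verdict` — a `True` carrier for the record (read the docstring).

LINE `SketchIdeator2` = card series-law-at-every-laplace-frequency, skeleton `Lines/SketchIdeator2.lean` (6 stubs, the
composition `AbelThermodynamicLimit_of` kernel-checked).  Stub by stub, after elaboration, read-back against the
Literature definitions (`transitionKernel` = pushed-forward pathwise SDE solution map, a genuine Markov kernel;
`gibbsMeasure = volume.tilted (−H/T)`; `bondCurrent` free-end convention; `t.toNNReal` harmless on `Ioi 0`;
Bochner/`IntegrableOn` junk excluded for `F_N` by the landed (K)), mutation of hypotheses, and the corners of §2: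

* QS `stub_quasiSuperadditivity` — NOT broken.  Its DC shadow `(N−1)D_N + (M−1)D_M − C ≤ (N+M−1)D_{N+M}` holds
  with `C = 0` whenever `N ↦ D_N` is non-decreasing (the universal numerical observation for these chains), and in the
  Kapitza caricature `D_N = κN/(N+ℓ)`; exact Gaussian/flip members: `C = 0` (lead's jobs).  Kill: `D_N` overshooting `κ`
  or approaching it from ABOVE slower than `1/N` at one admissible point (`not_qsShape_of_excess_from_above`) — no such
  behaviour is in print for a pinned chain.
* QSR `stub_quasiSuperadditiveResistance` — NOT broken; it IMPLIES the live crux `SuperadditiveResistance`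
  (stmt-11748) at DC for the canonical response (`dcShadow_of_freqResolved` + (K) + forced positivity), whose seat's
  verdict is `resists`, and it inherits that crux's kills verbatim (`not_qsrShape_of_rpow_correction`, and the log
  version in the landed file): approach from BELOW slower than `1/N`.  The harmonic corner is a consistency check,
  not a kill: by `HarmonicCornerTightness` (stmt-11748, landed) the junction constant must exceed the ballistic
  resistance `1/fluxLimit ω₂ γ` as `(lam, β) → 0` — the lead's exact jobs see exactly `C → 1/G_∞`.  What the
  FREQUENCY-uniformity adds over DC (heuristic, not formalised): in the hand-over window `ν_Th(N+M) < ν < ν_Th(N)`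
  the defect is `≈ 2ℓ/κ + (N+M)(Â(ν) − T²κ)/(κÂ(ν))`, so ν-uniformity secretly asserts a one-sided modulus
  `(Â(ν) − Â(0⁺))₊ ≲ C/L_Th(ν)` (`L_Th(ν)` the length whose Thouless frequency is `ν`): with diffusive `ν_Th ∼ L⁻²`
  this is Hölder-½ of `Â` at `0⁺` from above — exactly the borderline regularity the route itself expects of the
  spectral density (`WindowDecomposition`: "only Hölder-1/2 continuity of g is expected, t^{-3/2} tails"); QS asserts
  the mirror bound on `(Â(0⁺) − Â(ν))₊`.  A `t^{-1-a}` tail of `C_T` with `a < 1/2` and the wrong sign at one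
  admissible point would kill the corresponding law; nothing of the kind is established for any pinned anharmonic
  chain (for a single conserved field the leading mode-coupling tail of the TOTAL current vanishes — `j = −D(e)∂ₓe`
  is a gradient — so a slow tail, if any, is sub-leading).
* THE PAIR QS ∧ QSR — the genuinely new exposure of this line: two-sidedness.  `twoSided_envelope`/`twoSided_dc_law`:
  the plain stubs prove `|F_N(ν) − NÂ(ν)| = O(1)` on the whole window and `D_N = κ + O(1/N)`.  The card's de
  Bruijn–Erdős relaxation (allowance `f(N+M)`, `Σ f(n)/n² < ∞`; NOT the registered stubs) would tolerate every
  power-law correction and die only at corrections slower than `≈ 1/log N`; if the lead's MD of the real chain shows a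
  sub-`1/N` law, the registered stubs are false as typed and the reshape is forced.
* S3 `stub_fixedFrequencyMatching` — NOT broken; infrastructure-true in its regular-witness class (light cone at fixed
  `ν`, contact layers `O(1/ν)/N → 0`).  It silently carries uniqueness content: `matching_pins_kappa` — all regular
  witnesses share `Â` and `κ` (true if the superstable dynamics is unique on `bmGood` ∩ full measure, which is what
  `D.unique` + BM give; DLR uniqueness in the regular class is its inline hypothesis = S7).
* SEAM `stub_witnessRegularisation` — not attackable cheaply: false only if a NON-regular witness exists while no
  regular one does, i.e. only together with the failure of the route's own target for regular states.
* POS `stub_resolventFormPos` — TRUE (resolvent inequality `⟨u, R_ν u⟩ ≥ ν‖R_ν u‖² > 0` for `u = J ≠ 0` in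
  `L²(μ_{N,T})`, `N ≥ 2`; equivalently `c_N` is a stationary autocovariance, hence positive-definite, and
  `F_N(ν) = ∫ ν/(ν²+ω²) dS_N(ω) > 0`).  Not a disprover's target.
* S7 `stub_regularDLRUnique` — printed (Dobrushin / COPP 1978 class); not attackable cheaply.
* JOINT SUFFICIENCY — the composition is kernel-checked; no gap is smuggled: the witness OUTPUT is the regularised
  one, `0 < D_N` is derived, (K) and `0 ≤ D_N` are landed.

Verdict of this cycle: the crux RESISTS (as in §4, with (1) now free); the line can die only through QS/QSR being
false for the real chain at some admissible point, which is decidable by no cheap means here (the lead's own MD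
falsifier is the right experiment; an `N`-growing DC defect `2R_N − R_{2N}` or a two-sided `|(N−1)D_N − Nκ| → ∞` is
the fingerprint, `twoSided_dc_law`). -/
theorem line_SketchIdeator2_verdict : True := trivial

end Seat14013

end Summit.AtomisticToContinuum.FouriersLaw.Cruxes.AbelThermodynamicLimit.Disproof

end
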